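import Literature.MathematicalPhysics.QuantumFieldTheory.Balaban1983to89.T4BranchingRecordsGas

/-!
# `Balaban1983to89.T4TaggedShapeBanking` — the printed-shape banking and the branching-records seam RE-TYPED over an
arbitrary label type `ε` with a SHAPE MAP `sh : ε → PEv`: every physical history, parallel equal births included, is a
well-formed CONSISTENT tagged genealogy, while the prices, the tree weights and the count see shapes only (cell
`pub-balaban`, T4-DAG §5 self-row T4-U5c.E-NE7b-TAGGED-K* (§8 Q24(a)), node U5c / U5.E, spine estimate NE7b, COUNT
member P1 "Peierls / entropy–energy counting of persistent large-field histories", gen 14; record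
`t4/T4-EST-NE7b-P1.md` v1.14; GAPS G-ne7bp1g13-2 = symptom (ii) of G-ne7bp1g12-1 (LM); kernel bookkeeping — finite
combinatorics + real arithmetic; imports `T4BranchingRecordsGas` (this lineage, v1 p192542) BY NAME and modifies
nothing.  VERSION v1 = this file.)

HONEST FRAMING (T4-DAG PAGE 1).  The cell's T4 target is the existence and uniqueness of the `ε → 0` limit of unit-scale
block-averaged expectations on a FIXED finite torus, at rung (B)+1, CONDITIONAL on Bałaban's ultraviolet stability (B)
and on BetaPertH; it is NOT infinite volume, NOT the mass gap, NOT the Clay problem.  This module is [folklore] finite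
combinatorics and real analysis and READS NOTHING NEW from print: no sentence of [Balaban1989LargeFieldII] (cell paper
B16, CMP 122 (1989) 355–392) or of [Balaban1988Convergent] (B14, CMP 119 (1988) 243–285) is a hypothesis of anything
here, and nothing is quoted.  (B), BetaPertH, (B^μ), the reading (ID), the menus and the four budgets of the count are
DISPLAYED BINDERS of the theorems below, exactly as in `T4BranchingRecordsGas` — none is hidden in a definition.  Value =
a kernel certificate about OUR OWN counting chain; NOT an estimate of Bałaban's expansion; NOT summit progress; NOT a
proof of NE7b.

THE LOCATED POINT (GAPS G-ne7bp1g13-2; symptom (ii) of G-ne7bp1g12-1 (LM)).  `T4BranchingRecordsGas` counts pending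
histories as genealogy TERMS over class shapes — parallel branches with equal labels are separate subterms, so the COUNT
needs no distinctness of labels.  But its labelling binder `hlabB` asks, per counted term `G`, for a CONSISTENT,
WELL-FORMED genealogy `G̃` OVER THE DICTIONARY'S EVENTS `PEv = (step, kind, class)` with `relabel shape G̃ = G`, and
`Gen.WF` over `PEv` needs pairwise distinct labels along the history.  A renewal's or a merger's class coordinate is a free
tag (`shape` forgets it; `T4RecordPriceSeam` §4), so simultaneous same-shape renewals / mergers are harmless there; but
`shape` KEEPS a birth's class (the birth price depends on it), so a physical history with two PARALLEL BIRTHS of the same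
step and class — two large-field regions of equal fatness class born at the same step in different branches, later
merged — has NO well-formed `relabel shape`-preimage over `PEv` at all (§8 `no_wf_shapePreimage_Zflat`): on such
histories `hlabB`'s labelled branch is unsatisfiable, although the term is counted.  THE REPAIR (this module): labels of an
ARBITRARY type `ε` read through a shape map `sh : ε → PEv`; every PEv-level function of `T4PrintedShapeBanking` (`dictW`,
`wt`, `fw`, `supp`, `sz`, `wfloor`, `floorK`, `credit`, `Emarg`, `reserve`) and of `T4RecordPriceSeam` (`rho`, `eta`) is
read AT `sh e`, and only the genealogy-level objects — the booked cost, the merger extension, the admissibility predicate,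
the `Banking` instance and the seam — are re-typed over `Gen ε` and re-proved BY THE SAME PROOFS, which use only the
PEv-coordinates of each event and the ledger order, never injectivity of labels.  With `ε = PEv × ℕ` (a branch-local
ordinal; §8) every physical history is a well-formed consistent tagged genealogy, while `rho` / `eta` / `treeWt` and the
count see shapes only (`treeWt_relabel_shapeT`).  At `ε = PEv`, `sh = id` everything is the untagged object of
`T4PrintedShapeBanking` DEFINITIONALLY (§7).
  §1 TAGGED SHAPES.  `dictWT sh R n₁ e := dictW R n₁ (sh e)` (the window table read through the shape), `costT`, `extnT`,
     `ConsistentT` = `cost`, `extn`, `Consistent` of `T4PrintedShapeBanking` with `e ↦ sh e` in every PEv-coordinate;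
     additivity of the booking over the ledger (`costT_born`, `costT_renew_eq`, `costT_merge_eq`).
  §2 THE INVARIANTS of consistent tagged genealogies (`rootStep_le_reach`, `event_window`, `root_spec`, `absorbed_spec`,
     `rootStep_le_place`, `place_add_le_reach`, `cost_eq_zero`) — verbatim transports.
  §3 THE FOUR BINDERS HOLD given (2.9) and the three scale-indexed pay inequalities (`bornT_holds` — from the untagged
     `born_holds` at the label `sh b`; `renewT_past_eq`, `renewT_holds`, `lifeCostT_merge_eq` (EXACT), `mergeT_pay_holds`);
     `banking_taggedShape : Banking (ConsistentT sh C K R) (dictWT sh R C.n₁) (costT sh C K R) (credit C g ∘ sh)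
     (fun e ↦ κ₁·dictWT e + Emarg (sh e)) (reserve C g ∘ sh) (extnT sh C K R)`.
  §4 THE PAY SIDE IS LABEL-FREE: `payIneqs_of_flow` (the three pay inequalities from typed (2.7), (2.5), the exponent
     conditions and the γ-clauses — the arithmetic of `banking_printedShape_of_flow`, stated once with NO label type in
     sight), `exists_payThreshold` (ONE number `x₀`, constants only, such that `x₀ ≤ log g_K⁻²` along a run of the typed
     flow gives all three), hence `exists_irThresholdT` for EVERY `ε`, `sh` — the same `x₀` as the untagged
     `exists_irThreshold` (re-derived from it here: `banking_printedShape_of_payThreshold`).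
  §5 THE PRICE: `taggedShape_recordPrice` (= `T4BankedInduction.rawFactor_le_recordPrice`, generic, by name),
     `rawFactor_le_shapeT`, `root_priceT`, `partnerAges_le_windowSurplusT`.
  §6 THE SEAM: `treeShape_of_labelBT` (one tagged genealogy: the generic bridge `treeShape_of_mulRawShape` of
     `T4BranchingRecordsGas`, by name), `treeWt_relabel_shapeT` (`treeWt (rho C g) (eta C) θ PEv.step (relabel (shape ∘ sh)
     G̃) = treeWt (rho C g ∘ sh) (eta C ∘ sh) θ (PEv.step ∘ sh) G̃`), `treeShape_of_labelT` = the new labelling binder at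
     one slot, and END TO END `exists_relWeightBound_of_bankingT`, `exists_irThreshold_relWeightBoundT` =
     `T4BranchingRecordsGas.exists_relWeightBound_of_bankingB` / `exists_irThreshold_relWeightBoundB` with `hlabB ↦ hlabT`:
     `y ≤ 0 ∨ ∃ G̃ : Gen ε, ConsistentT sh … G̃ ∧ G̃.WF (dictWT sh …) ∧ K < reach G̃ ∧ relabel (shape ∘ sh) G̃ = G ∧
     y ≤ Λ′^{partnerAges (PEv.step ∘ sh) G̃}·e^{−credits (credit ∘ sh) G̃}·e^{+lifeCost … (costT sh …) G̃}` — the count side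
     (menus, budgets, fuel, slots, `Regeneration`, root rate, budget `recordsBudget`) UNCHANGED and still over shapes.
  §7 CONSERVATIVE EXTENSION: at `ε = PEv`, `sh = id`: `dictWT id = dictW`, `costT id = cost`, `extnT id = extn` (`rfl`) and
     `ConsistentT id ↔ Consistent`; so `banking_printedShape` is the instance `sh = id` up to these identifications.
  §8 SANITY (decided / by `simp`): over `ε = PEv × ℕ`, `sh = Prod.fst`, the two-branch history `Zt = merge Xt Yt ((5,2,0),0)`
     whose branches are born at the SAME step `0` with the SAME class `0` (labels `((0,0,0),0)`, `((0,0,0),1)`) and renew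
     at the same step `4` is well formed AND consistent at cutoff `8` (pending: `8 < 10 = reach`) on the table `R ≡ 2`,
     `n₁ = 1` of `T4PrintedShapeBanking.XreadC4.C₀`; its shape `Zflat = relabel (shape ∘ Prod.fst) Zt` is a branching record
     (`∈ fam … (n + 3) {(0,0,0)} 0 8`, counted) which is NOT well formed and has NO well-formed `relabel shape`-preimage over
     `PEv` whatsoever (`no_wf_shapePreimage_Zflat`) — so `hlabB` could not be met on it while `hlabT` is (exhibited).
WHAT THIS DOES NOT DO.  (i) It does not discharge `hlabT`: that every pending structure of cutoff `K` is priced by SOME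
consistent well-formed TAGGED genealogy whose shape lies in `runFam` (time-ordered, older line first, fuel `≤ Ncap K`,
roots / partners from the menus) with multiplicity `Λ′^{partnerAges}` is the READING (ID) of print's inductive definition of
the persistent regions plus the GEOMETRIC multiplicity statement — GAPS G-ne7bp1g9-1 / G-ne7bp1g12-1 (GM), owner O-R10 —
displayed; `hlabT` is its typed target (the count member's fourth and intended-final binder shape: `hlab` → `hlabM` →
`hlabB` → `hlabT`).  (ii) The budgets `hρbar`, `ha`, `hμ`, `hν`, the fuel `Ncap`, the age datum `Λ′` with
`Λ′e^{−κ₁}e^{η̄₊} < 1` and the fixed-point side condition are displayed, not derived.  (iii) It does not touch the typed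
flow, the infrared smallness, `Regeneration`, the domination `hF`, (G2)/(G5), or any module of another seat; it adds
tagged copies next to the untagged objects and changes none of them.

References (locators only, nothing quoted): [Balaban1989LargeFieldII] (1.79) p. 383, (1.82) p. 385, (1.84)–(1.89)
pp. 385–388; [Balaban1988Convergent] (2.5), (2.7) p. 255, (2.9) p. 256 — as typed in `B14` / `B14FlowStep` and read in
`T4PrintedShapeBanking` / `T4PersistenceDictionary` / `T4RecordPriceSeam` / `T4PartnerMultiplicity` / `T4BranchingRecordsGas`.
-/

open Finset

namespace Literature.MathematicalPhysics.QuantumFieldTheory.Balaban1983to89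

namespace T4TaggedShapeBanking

open T4PersistenceDictionary T4PersistentHistoryCount T4BankedInduction T4PrintedShapeBanking
open T4WeightBudget T4GlobalDenominator T4LiveClassFibration T4LiveStructureGas T4LiveGasToTerms T4RecordPriceSeam
open T4PartnerMultiplicity T4BranchingRecordsGas

noncomputable section

/-! ## §1 Tagged shapes: the window table, the booked cost, the merger extension and admissibility through `sh` -/

section Shapes

variable {ε : Type*} [DecidableEq ε]

/-- **THE TAGGED WINDOW TABLE**: a label's window is the dictionary's window of its shape, `dictW R n₁ (sh e)`.
[folklore] -/
abbrev dictWT (sh : ε → PEv) (R : ℕ → ℕ) (n₁ : ℕ) : ε → ℕ := fun e => dictW R n₁ (sh e)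

omit [DecidableEq ε] in
/-- the tagged table at a label [folklore] -/
theorem dictWT_apply (sh : ε → PEv) (R : ℕ → ℕ) (n₁ : ℕ) (e : ε) : dictWT sh R n₁ e = dictW R n₁ (sh e) := rfl

omit [DecidableEq ε] in
/-- the tagged table is the table composed with the shape map [folklore] -/
theorem dictWT_eq_comp (sh : ε → PEv) (R : ℕ → ℕ) (n₁ : ℕ) : dictWT sh R n₁ = dictW R n₁ ∘ sh := rfl

variable (sh : ε → PEv) (C : T4PrintedShapeBanking.Consts) (K : ℕ) (R : ℕ → ℕ)

/-- **THE BOOKED PER-STEP CONTROL COST of a tagged genealogy at step `n`** — `T4PrintedShapeBanking.cost` with every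
event read through its shape: each event books its window floor on its placed window `[place e, place e + dictWT e)` and
its own size cost on its epoch. [folklore] -/
def costT (G : Gen ε) (n : ℕ) : ℝ :=
  ∑ e ∈ G.events, (wfloor C K R (G.place (dictWT sh R C.n₁) e) (sh e) n + sz C K R (sh e) n)

/-- **THE MERGER EXTENSION** — `T4PrintedShapeBanking.extn` through the shape: the floor over the merger's window beyond
the later partner reach plus the connector's whole size cost. [folklore] -/
def extnT (X Y : Gen ε) (e : ε) : ℝ :=
  ∑ n ∈ Finset.Ico (max (X.reach (dictWT sh R C.n₁)) (Y.reach (dictWT sh R C.n₁)))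
      (max (X.reach (dictWT sh R C.n₁)) (Y.reach (dictWT sh R C.n₁)) + dictWT sh R C.n₁ e), floorK C K R n +
    ∑ n ∈ supp C (sh e), sz C K R (sh e) n

/-- **CONSISTENT TAGGED GENEALOGIES** — `T4PrintedShapeBanking.Consistent` through the shape: a birth label has shape of
kind `0` at its own step `j ≤ K`; a renewal label has kind `1`, step `h + 1 ≤ K`, AT READINESS `h + 1 = reach`; a merger
label has kind `2` and a step `≤ K` in both partners' pending lives.  Nothing is asked of the tags. [folklore] -/
def ConsistentT : Gen ε → Prop
  | Gen.born b j => (sh b).kind = 0 ∧ (sh b).step = j ∧ j ≤ K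
  | Gen.renew G e h => ConsistentT G ∧ (sh e).kind = 1 ∧ (sh e).step = h + 1 ∧
      h + 1 = G.reach (dictWT sh R C.n₁) ∧ h + 1 ≤ K
  | Gen.merge X Y e => ConsistentT X ∧ ConsistentT Y ∧ (sh e).kind = 2 ∧
      X.rootStep ≤ (sh e).step ∧ (sh e).step < X.reach (dictWT sh R C.n₁) ∧
      Y.rootStep ≤ (sh e).step ∧ (sh e).step < Y.reach (dictWT sh R C.n₁) ∧ (sh e).step ≤ K

variable {sh C K R}

omit [DecidableEq ε] in
/-- a birth-shaped label's window is `fatWait d′ + R_s + 1` [folklore] -/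
theorem dictWT_kind0 {n₁ : ℕ} {e : ε} (h : (sh e).kind = 0) :
    dictWT sh R n₁ e = fatWait (sh e).fat + R (sh e).step + 1 := dictW_kind0 h
omit [DecidableEq ε] in
/-- a renewal-shaped label's window is `R_s + 1` [folklore] -/
theorem dictWT_kind1 {n₁ : ℕ} {e : ε} (h : (sh e).kind = 1) : dictWT sh R n₁ e = R (sh e).step + 1 := dictW_kind1 h
omit [DecidableEq ε] in
/-- a merger-shaped label's window is `n₁ + R_s` [folklore] -/
theorem dictWT_kind2 {n₁ : ℕ} {e : ε} (h : (sh e).kind = 2) : dictWT sh R n₁ e = n₁ + R (sh e).step := dictW_kind2 h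

/-- per-step control costs are nonnegative. [folklore] -/
theorem costT_nonneg (hE₂ : 0 ≤ C.E₂) (hE₃ : 0 ≤ C.E₃) (G : Gen ε) (n : ℕ) : 0 ≤ costT sh C K R G n :=
  Finset.sum_nonneg fun e _ => add_nonneg (wfloor_nonneg hE₂ _ (sh e) n) (sz_nonneg hE₃ (sh e) n)

/-- a bare region books its own window floor and size cost. [folklore] -/
theorem costT_born (b : ε) (j n : ℕ) :
    costT sh C K R (Gen.born b j) n = wfloor C K R j (sh b) n + sz C K R (sh b) n := by
  simp [costT]

/-- a renewed component books the old component's costs plus the renewal's own window floor (and size cost): the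
renewal is a new LABEL (`e ∉ G.events`, `Gen.WF` — of the tag, not of the shape). [folklore] -/
theorem costT_renew_eq {G : Gen ε} {e : ε} (he : e ∉ G.events) (h n : ℕ) :
    costT sh C K R (Gen.renew G e h) n = costT sh C K R G n + (wfloor C K R (h + 1) (sh e) n + sz C K R (sh e) n) := by
  have hsum : ∑ e' ∈ G.events, (wfloor C K R ((Gen.renew G e h).place (dictWT sh R C.n₁) e') (sh e') n +
        sz C K R (sh e') n) =
      ∑ e' ∈ G.events, (wfloor C K R (G.place (dictWT sh R C.n₁) e') (sh e') n + sz C K R (sh e') n) :=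
    Finset.sum_congr rfl fun e' he' => by
      have hne : e' ≠ e := fun hq => he (hq ▸ he')
      rw [Gen.place_renew, if_neg hne]
  unfold costT
  rw [Gen.events_renew, Finset.sum_insert he, Gen.place_renew_self, hsum]
  ring

/-- a merged component books both partners' costs plus the merger's own window floor and connector — additivity over the
partners' disjoint LABEL sets. [folklore] -/
theorem costT_merge_eq {X Y : Gen ε} {e : ε} (heX : e ∉ X.events) (heY : e ∉ Y.events)
    (hXY : Disjoint X.events Y.events) (n : ℕ) :
    costT sh C K R (Gen.merge X Y e) n = costT sh C K R X n + costT sh C K R Y n +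
      (wfloor C K R (max (X.reach (dictWT sh R C.n₁)) (Y.reach (dictWT sh R C.n₁))) (sh e) n + sz C K R (sh e) n) := by
  have he : e ∉ X.events ∪ Y.events := by simp [heX, heY]
  have hX : ∑ e' ∈ X.events, (wfloor C K R ((Gen.merge X Y e).place (dictWT sh R C.n₁) e') (sh e') n +
        sz C K R (sh e') n) =
      ∑ e' ∈ X.events, (wfloor C K R (X.place (dictWT sh R C.n₁) e') (sh e') n + sz C K R (sh e') n) :=
    Finset.sum_congr rfl fun e' he' => by
      have hne : e' ≠ e := fun hq => heX (hq ▸ he')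
      rw [Gen.place_merge, if_neg hne, if_pos he']
  have hY : ∑ e' ∈ Y.events, (wfloor C K R ((Gen.merge X Y e).place (dictWT sh R C.n₁) e') (sh e') n +
        sz C K R (sh e') n) =
      ∑ e' ∈ Y.events, (wfloor C K R (Y.place (dictWT sh R C.n₁) e') (sh e') n + sz C K R (sh e') n) :=
    Finset.sum_congr rfl fun e' he' => by
      have hne : e' ≠ e := fun hq => heY (hq ▸ he')
      rw [Gen.place_merge, if_neg hne, if_neg (Finset.disjoint_right.1 hXY he')]
  unfold costT
  rw [Gen.events_merge, Finset.sum_insert he, Finset.sum_union hXY, Gen.place_merge_self, hX, hY]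
  ring

end Shapes

/-! ## §2 The invariants of consistent tagged genealogies -/

section AdmissibleT

variable {ε : Type*} [DecidableEq ε] {sh : ε → PEv} {C : T4PrintedShapeBanking.Consts} {K : ℕ} {R : ℕ → ℕ}

omit [DecidableEq ε] in
/-- A consistent tagged genealogy is born no later than it ends. [folklore] -/
theorem ConsistentT.rootStep_le_reach :
    ∀ {G : Gen ε}, ConsistentT sh C K R G → G.rootStep ≤ G.reach (dictWT sh R C.n₁)
  | Gen.born b j, _ => by simp
  | Gen.renew G e h, hc => by
      simp only [ConsistentT] at hc
      obtain ⟨hG, -, -, hr, -⟩ := hc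
      have := ConsistentT.rootStep_le_reach hG
      simp only [Gen.rootStep_renew, Gen.reach_renew]
      omega
  | Gen.merge X Y e, hc => by
      simp only [ConsistentT] at hc
      obtain ⟨-, -, -, hx, hx', -, -, -⟩ := hc
      simp only [Gen.rootStep_merge, Gen.reach_merge]
      omega

/-- every event's size epoch lies inside the structure's own life (`rootStep ≤ (sh e).step`,
`(sh e).step + fw (sh e) < reach`). [folklore] -/
theorem ConsistentT.event_window (hdC : fatWait C.dC ≤ C.n₁) :
    ∀ {G : Gen ε}, ConsistentT sh C K R G → ∀ e ∈ G.events,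
      G.rootStep ≤ (sh e).step ∧ (sh e).step + fw C (sh e) < G.reach (dictWT sh R C.n₁)
  | Gen.born b j, hc, e, he => by
      simp only [ConsistentT] at hc
      obtain ⟨hk, hs, -⟩ := hc
      simp only [Gen.events_born, Finset.mem_singleton] at he
      subst he
      simp only [Gen.rootStep_born, Gen.reach_born]
      rw [dictWT_kind0 hk, fw_kind0 hk]
      omega
  | Gen.renew G e h, hc, e', he' => by
      simp only [ConsistentT] at hc
      obtain ⟨hG, hk, hs, hr, -⟩ := hc
      simp only [Gen.events_renew, Finset.mem_insert] at he'
      simp only [Gen.rootStep_renew, Gen.reach_renew]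
      have hroot := ConsistentT.rootStep_le_reach hG
      rcases he' with rfl | he'
      · rw [fw_kind1 hk, dictWT_kind1 hk]
        omega
      · have := ConsistentT.event_window hdC hG e' he'
        omega
  | Gen.merge X Y e, hc, e', he' => by
      simp only [ConsistentT] at hc
      obtain ⟨hX, hY, hk, hx, hx', hy, hy', -⟩ := hc
      simp only [Gen.events_merge, Finset.mem_insert, Finset.mem_union] at he'
      simp only [Gen.rootStep_merge, Gen.reach_merge]
      rcases he' with rfl | he' | he'
      · rw [fw_kind2 hk, dictWT_kind2 hk]
        omega
      · have := ConsistentT.event_window hdC hX e' he'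
        omega
      · have := ConsistentT.event_window hdC hY e' he'
        omega

omit [DecidableEq ε] in
/-- the root of a consistent tagged genealogy has birth shape, at `rootStep`. [folklore] -/
theorem ConsistentT.root_spec :
    ∀ {G : Gen ε}, ConsistentT sh C K R G → (sh G.root).kind = 0 ∧ (sh G.root).step = G.rootStep
  | Gen.born b j, hc => by
      simp only [ConsistentT] at hc
      exact ⟨by simpa using hc.1, by simpa using hc.2.1⟩
  | Gen.renew G e h, hc => by
      simp only [ConsistentT] at hc
      simpa using ConsistentT.root_spec hc.1
  | Gen.merge X Y e, hc => by
      simp only [ConsistentT] at hc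
      obtain ⟨hX, hY, -⟩ := hc
      have h1 := ConsistentT.root_spec hX
      have h2 := ConsistentT.root_spec hY
      rw [root_merge, Gen.rootStep_merge]
      split_ifs with h
      · exact ⟨h1.1, by rw [h1.2, min_eq_left h]⟩
      · exact ⟨h2.1, by rw [h2.2, min_eq_right (not_le.mp h).le]⟩

omit [DecidableEq ε] in
/-- the absorbed root of a consistent merger has birth shape, no later than the merger step. [folklore] -/
theorem ConsistentT.absorbed_spec {X Y : Gen ε} {e : ε} (hc : ConsistentT sh C K R (Gen.merge X Y e)) :
    (sh (absorbed X Y)).kind = 0 ∧ (sh (absorbed X Y)).step ≤ (sh e).step := by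
  simp only [ConsistentT] at hc
  obtain ⟨hX, hY, -, hx, -, hy, -, -⟩ := hc
  unfold absorbed
  split_ifs
  · exact ⟨(ConsistentT.root_spec hY).1, by rw [(ConsistentT.root_spec hY).2]; exact hy⟩
  · exact ⟨(ConsistentT.root_spec hX).1, by rw [(ConsistentT.root_spec hX).2]; exact hx⟩

/-- every event's window opens no earlier than the root birth. [folklore] -/
theorem ConsistentT.rootStep_le_place :
    ∀ {G : Gen ε}, ConsistentT sh C K R G → ∀ e ∈ G.events, G.rootStep ≤ G.place (dictWT sh R C.n₁) e
  | Gen.born b j, _, e, _ => le_rfl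
  | Gen.renew G e h, hc, e', he' => by
      simp only [ConsistentT] at hc
      obtain ⟨hG, -, -, hr, -⟩ := hc
      have hroot := ConsistentT.rootStep_le_reach hG
      rw [Gen.rootStep_renew, Gen.place_renew]
      split_ifs with h1
      · omega
      · rw [Gen.events_renew, Finset.mem_insert] at he'
        exact ConsistentT.rootStep_le_place hG e' (he'.resolve_left h1)
  | Gen.merge X Y e, hc, e', he' => by
      simp only [ConsistentT] at hc
      obtain ⟨hX, hY, -, hx, hx', -, -, -⟩ := hc
      rw [Gen.rootStep_merge, Gen.place_merge]
      split_ifs with h1 h2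
      · have := le_max_left (X.reach (dictWT sh R C.n₁)) (Y.reach (dictWT sh R C.n₁))
        omega
      · exact (min_le_left _ _).trans (ConsistentT.rootStep_le_place hX e' h2)
      · rw [Gen.events_merge, Finset.mem_insert, Finset.mem_union] at he'
        have he'Y : e' ∈ Y.events := by tauto
        exact (min_le_right _ _).trans (ConsistentT.rootStep_le_place hY e' he'Y)

/-- every event's window closes no later than the reach. [folklore] -/
theorem ConsistentT.place_add_le_reach :
    ∀ {G : Gen ε}, ConsistentT sh C K R G → ∀ e ∈ G.events,
      G.place (dictWT sh R C.n₁) e + dictWT sh R C.n₁ e ≤ G.reach (dictWT sh R C.n₁)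
  | Gen.born b j, _, e, he => by
      simp only [Gen.events_born, Finset.mem_singleton] at he
      subst he
      simp
  | Gen.renew G e h, hc, e', he' => by
      simp only [ConsistentT] at hc
      obtain ⟨hG, -, -, hr, -⟩ := hc
      rw [Gen.reach_renew, Gen.place_renew]
      split_ifs with h1
      · subst h1
        exact le_rfl
      · rw [Gen.events_renew, Finset.mem_insert] at he'
        have := ConsistentT.place_add_le_reach hG e' (he'.resolve_left h1)
        omega
  | Gen.merge X Y e, hc, e', he' => by
      simp only [ConsistentT] at hc
      obtain ⟨hX, hY, -⟩ := hc
      rw [Gen.reach_merge, Gen.place_merge]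
      split_ifs with h1 h2
      · subst h1
        exact le_rfl
      · have := ConsistentT.place_add_le_reach hX e' h2
        have := le_max_left (X.reach (dictWT sh R C.n₁)) (Y.reach (dictWT sh R C.n₁))
        omega
      · rw [Gen.events_merge, Finset.mem_insert, Finset.mem_union] at he'
        have he'Y : e' ∈ Y.events := by tauto
        have := ConsistentT.place_add_le_reach hY e' he'Y
        have := le_max_right (X.reach (dictWT sh R C.n₁)) (Y.reach (dictWT sh R C.n₁))
        omega

/-- the booked cost lives on the life `[rootStep, reach)`. [folklore] -/
theorem ConsistentT.cost_eq_zero (hdC : fatWait C.dC ≤ C.n₁) {G : Gen ε} (hc : ConsistentT sh C K R G) {n : ℕ}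
    (hn : n ∉ life (dictWT sh R C.n₁) G) : costT sh C K R G n = 0 := by
  rw [mem_life, not_and_or, not_le, not_lt] at hn
  unfold costT
  refine Finset.sum_eq_zero fun e he => ?_
  have h1 := ConsistentT.rootStep_le_place hc e he
  have h2 := ConsistentT.place_add_le_reach hc e he
  have h3 := ConsistentT.event_window hdC hc e he
  have hw : n ∉ Finset.Ico (G.place (dictWT sh R C.n₁) e) (G.place (dictWT sh R C.n₁) e + dictWT sh R C.n₁ e) := by
    rw [Finset.mem_Ico]
    omega
  have hs : n ∉ supp C (sh e) := by
    simp only [supp, Finset.mem_Ioc]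
    omega
  rw [wfloor_of_not_mem hw, sz_eq_zero_of_not_mem hs, add_zero]

end AdmissibleT

/-! ## §3 The tagged shapes inhabit `Banking` given (2.9) and the three scale-indexed pay inequalities -/

section InhabitT

variable {ε : Type*} [DecidableEq ε] {sh : ε → PEv} {C : T4PrintedShapeBanking.Consts} {K L : ℕ} {R : ℕ → ℕ}
  {g : ℕ → ℝ} {β' β₀ : ℝ}

/-- **BIRTH**: a consistent bare region's exponent pays its own epoch, keeps bank and reserve — the untagged
`T4PrintedShapeBanking.born_holds` AT THE LABEL `sh b` (a bare region books exactly what its shape books). [folklore] -/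
theorem bornT_holds (hC : C.Valid) (h29 : B14FlowStep.FlowIneq29 R g L β' β₀ K) (hL : 1 ≤ L)
    (hR1 : ∀ s, s ≤ K → 1 ≤ R s)
    (Hb : ∀ s, s ≤ K → ∀ d' : ℕ,
      (C.Eb + C.μ + (3 * C.E₂ * (L : ℝ) ^ C.q' + C.E₃ * (L : ℝ) ^ C.q' + 3 * C.κ₁) * (R s : ℝ) ^ (C.q' + 1)) *
          ((d' : ℝ) + 1) + 2 * p0Profile C.A₀ C.p₀ (g s) ≤
        C.a * (p0Profile C.A₀ C.p₀ (g s)) ^ 2 * ((d' : ℝ) + 1) + 2 * p0Profile C.A₀ C.p₀ (g s))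
    (b : ε) (j : ℕ) (hc : ConsistentT sh C K R (Gen.born b j)) :
    ∑ n ∈ Finset.Ico j (j + dictWT sh R C.n₁ b), costT sh C K R (Gen.born b j) n +
      (C.κ₁ * ((dictWT sh R C.n₁ b : ℕ) : ℝ) + Emarg C (sh b)) + reserve C g (sh b) ≤ credit C g (sh b) := by
  have hc' : Consistent C K R (Gen.born (sh b) j) := by simpa only [ConsistentT, Consistent] using hc
  have h := born_holds hC h29 hL hR1 Hb (sh b) j hc'
  simp only [cost_born] at h
  simpa only [costT_born, dictWT_apply] using h

/-- **RENEWAL, PAST** (exact): before its window opens the renewed component books exactly the old component's costs.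
[folklore] -/
theorem renewT_past_eq (G : Gen ε) (e : ε) (h : ℕ) (hc : ConsistentT sh C K R (Gen.renew G e h))
    (hW : (Gen.renew G e h).WF (dictWT sh R C.n₁)) (n : ℕ) (hn : n ≤ h) :
    costT sh C K R (Gen.renew G e h) n = costT sh C K R G n := by
  simp only [ConsistentT] at hc
  obtain ⟨-, hk, -, -, -⟩ := hc
  simp only [Gen.WF] at hW
  obtain ⟨-, he, -, -⟩ := hW
  have h0 : sz C K R (sh e) n = 0 := sz_eq_zero_of_not_mem (by simp [supp, fw_kind1 hk])
  rw [costT_renew_eq he, wfloor_of_lt (by omega : n < h + 1), h0, add_zero, add_zero]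

/-- **RENEWAL**: at readiness the old component's booked cost is over, so in the new window the renewed component costs
exactly the floor; the factor `p₀(g_h)` pays it and the bank, given `Hr`. [folklore] -/
theorem renewT_holds (hC : C.Valid) (h29 : B14FlowStep.FlowIneq29 R g L β' β₀ K) (hL : 1 ≤ L)
    (hR1 : ∀ s, s ≤ K → 1 ≤ R s)
    (Hr : ∀ h, h + 1 ≤ K →
      2 * C.E₂ * (L : ℝ) ^ C.q' * (R (h + 1) : ℝ) ^ (C.q' + 1) + (C.κ₁ * ((R (h + 1) : ℝ) + 1) + C.E₀) ≤
        p0Profile C.A₀ C.p₀ (g h))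
    (G : Gen ε) (e : ε) (h : ℕ) (hc : ConsistentT sh C K R (Gen.renew G e h))
    (hW : (Gen.renew G e h).WF (dictWT sh R C.n₁)) :
    ∑ n ∈ Finset.Ico (h + 1) (h + 1 + dictWT sh R C.n₁ e), costT sh C K R (Gen.renew G e h) n +
      (C.κ₁ * ((dictWT sh R C.n₁ e : ℕ) : ℝ) + Emarg C (sh e)) ≤ credit C g (sh e) := by
  have hc' := hc
  simp only [ConsistentT] at hc'
  obtain ⟨hG, hk, hs, hr, hK⟩ := hc'
  have hW' := hW
  simp only [Gen.WF] at hW'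
  obtain ⟨-, he, -, -⟩ := hW'
  have hWn : dictWT sh R C.n₁ e = R (h + 1) + 1 := by rw [dictWT_kind1 hk, hs]
  have hcr : credit C g (sh e) = p0Profile C.A₀ C.p₀ (g h) := by rw [credit_kind1 hk, hs, Nat.add_sub_cancel]
  rw [hcr, Emarg_kind1 hk]
  have hcost : ∀ n ∈ Finset.Ico (h + 1) (h + 1 + dictWT sh R C.n₁ e),
      costT sh C K R (Gen.renew G e h) n = floorK C K R n := by
    intro n hn
    have hn1 : h + 1 ≤ n := (Finset.mem_Ico.1 hn).1
    have hG0 : costT sh C K R G n = 0 := ConsistentT.cost_eq_zero hC.dC_le hG (by rw [mem_life]; omega)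
    have hsz : sz C K R (sh e) n = 0 := sz_eq_zero_of_not_mem (by simp [supp, fw_kind1 hk])
    rw [costT_renew_eq he, hG0, wfloor_of_mem hn, hsz, zero_add, add_zero]
  rw [Finset.sum_congr rfl hcost]
  have hfl := sum_floorK_le h29 hL hC.E₂_nonneg (s := h + 1) (T := Finset.Ico (h + 1) (h + 1 + dictWT sh R C.n₁ e))
    (fun n hn => (Finset.mem_Ico.1 hn).1)
  rw [Nat.card_Ico, Nat.add_sub_cancel_left, hWn, mul_pow] at hfl
  push_cast at hfl
  have hP : (1 : ℝ) ≤ R (h + 1) := by exact_mod_cast hR1 (h + 1) hK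
  have key := renew_arith (Lq := (L : ℝ) ^ C.q') (E₂ := C.E₂) hP (by positivity) hC.E₂_nonneg C.q'
  have hpay := Hr h hK
  rw [hWn]
  push_cast
  linarith

/-- **MERGER, GEOMETRY — EXACT**: the merged structure's life cost is the two partners' life costs plus the extension
(additivity over the disjoint LABEL sets; each partner's cost lives on its own life; the merger's window and connector
epoch lie inside the merged life). [folklore] -/
theorem lifeCostT_merge_eq (hC : C.Valid) (X Y : Gen ε) (e : ε) (hc : ConsistentT sh C K R (Gen.merge X Y e))
    (hW : (Gen.merge X Y e).WF (dictWT sh R C.n₁)) :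
    lifeCost (dictWT sh R C.n₁) (costT sh C K R) (Gen.merge X Y e) =
      lifeCost (dictWT sh R C.n₁) (costT sh C K R) X + lifeCost (dictWT sh R C.n₁) (costT sh C K R) Y +
        extnT sh C K R X Y e := by
  have hc' := hc
  simp only [ConsistentT] at hc'
  obtain ⟨hX, hY, -, hx, hx', hy, hy', -⟩ := hc'
  have hW' := hW
  simp only [Gen.WF] at hW'
  obtain ⟨-, -, heX, heY, hXY, -, -⟩ := hW'
  have hrX := ConsistentT.rootStep_le_reach hX
  have hLX : life (dictWT sh R C.n₁) X ⊆ life (dictWT sh R C.n₁) (Gen.merge X Y e) := fun n hn => by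
    rw [mem_life] at hn ⊢
    rw [Gen.rootStep_merge, Gen.reach_merge]
    constructor <;> omega
  have hLY : life (dictWT sh R C.n₁) Y ⊆ life (dictWT sh R C.n₁) (Gen.merge X Y e) := fun n hn => by
    rw [mem_life] at hn ⊢
    rw [Gen.rootStep_merge, Gen.reach_merge]
    constructor <;> omega
  have hLM : Finset.Ico (max (X.reach (dictWT sh R C.n₁)) (Y.reach (dictWT sh R C.n₁)))
      (max (X.reach (dictWT sh R C.n₁)) (Y.reach (dictWT sh R C.n₁)) + dictWT sh R C.n₁ e) ⊆
        life (dictWT sh R C.n₁) (Gen.merge X Y e) := fun n hn => by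
    rw [Finset.mem_Ico] at hn
    rw [mem_life, Gen.rootStep_merge, Gen.reach_merge]
    constructor <;> omega
  have hLS : ∀ n ∈ supp C (sh e), n ∈ life (dictWT sh R C.n₁) (Gen.merge X Y e) := fun n hn => by
    have hw := ConsistentT.event_window hC.dC_le hc e (by simp)
    simp only [supp, Finset.mem_Ioc] at hn
    rw [mem_life]
    constructor <;> omega
  have hsumX : ∑ n ∈ life (dictWT sh R C.n₁) (Gen.merge X Y e), costT sh C K R X n =
      ∑ n ∈ life (dictWT sh R C.n₁) X, costT sh C K R X n :=
    (Finset.sum_subset hLX fun n _ hn => ConsistentT.cost_eq_zero hC.dC_le hX hn).symm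
  have hsumY : ∑ n ∈ life (dictWT sh R C.n₁) (Gen.merge X Y e), costT sh C K R Y n =
      ∑ n ∈ life (dictWT sh R C.n₁) Y, costT sh C K R Y n :=
    (Finset.sum_subset hLY fun n _ hn => ConsistentT.cost_eq_zero hC.dC_le hY hn).symm
  have hsumS : ∑ n ∈ life (dictWT sh R C.n₁) (Gen.merge X Y e), sz C K R (sh e) n =
      ∑ n ∈ supp C (sh e), sz C K R (sh e) n :=
    (Finset.sum_subset (fun n hn => hLS n hn) fun n _ hn => sz_eq_zero_of_not_mem hn).symm
  unfold lifeCost extnT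
  rw [Finset.sum_congr rfl fun n _ => costT_merge_eq heX heY hXY n, Finset.sum_add_distrib, Finset.sum_add_distrib,
    Finset.sum_add_distrib, hsumX, hsumY, sum_wfloor_eq hLM, hsumS]

omit [DecidableEq ε] in
/-- **MERGER, PAY**: the absorbed root's reserve `2p₀(g_m)` pays the extension and the merger's bank, given `Hm`.
[folklore] -/
theorem mergeT_pay_holds (hC : C.Valid) (h29 : B14FlowStep.FlowIneq29 R g L β' β₀ K) (hL : 1 ≤ L)
    (hR1 : ∀ s, s ≤ K → 1 ≤ R s)
    (Hm : ∀ m s, m ≤ s → s ≤ K →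
      ((1 + C.n₁) * C.E₂ * (L : ℝ) ^ C.q' + C.dC * C.E₃ * (L : ℝ) ^ C.q') * (R s : ℝ) ^ (C.q' + 1) +
          (C.κ₁ * ((C.n₁ : ℝ) + R s) + C.E₀) ≤ 2 * p0Profile C.A₀ C.p₀ (g m))
    (X Y : Gen ε) (e : ε) (hc : ConsistentT sh C K R (Gen.merge X Y e)) :
    extnT sh C K R X Y e + (C.κ₁ * ((dictWT sh R C.n₁ e : ℕ) : ℝ) + Emarg C (sh e)) ≤
      reserve C g (sh (absorbed X Y)) + credit C g (sh e) := by
  have hab := ConsistentT.absorbed_spec hc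
  have hc' := hc
  simp only [ConsistentT] at hc'
  obtain ⟨-, -, hk, -, hx', -, -, hsK⟩ := hc'
  have hWn : dictWT sh R C.n₁ e = C.n₁ + R (sh e).step := dictW_kind2 hk
  unfold extnT
  rw [credit_kind2 hk, Emarg_kind2 hk, reserve_kind0 hab.1, hWn]
  have hfl : ∑ n ∈ Finset.Ico (max (X.reach (dictWT sh R C.n₁)) (Y.reach (dictWT sh R C.n₁)))
        (max (X.reach (dictWT sh R C.n₁)) (Y.reach (dictWT sh R C.n₁)) + (C.n₁ + R (sh e).step)), floorK C K R n ≤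
      ((C.n₁ + R (sh e).step : ℕ) : ℝ) * (C.E₂ * ((L : ℝ) * R (sh e).step) ^ C.q') := by
    have h := sum_floorK_le h29 hL hC.E₂_nonneg (s := (sh e).step)
      (T := Finset.Ico (max (X.reach (dictWT sh R C.n₁)) (Y.reach (dictWT sh R C.n₁)))
        (max (X.reach (dictWT sh R C.n₁)) (Y.reach (dictWT sh R C.n₁)) + (C.n₁ + R (sh e).step)))
      (fun n hn => by
        have h1 := (Finset.mem_Ico.1 hn).1
        have h2 : (sh e).step < max (X.reach (dictWT sh R C.n₁)) (Y.reach (dictWT sh R C.n₁)) :=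
          lt_of_lt_of_le hx' (le_max_left _ _)
        omega)
    rwa [Nat.card_Ico, Nat.add_sub_cancel_left] at h
  have hszs : ∑ n ∈ supp C (sh e), sz C K R (sh e) n ≤ C.E₃ * ((L : ℝ) * R (sh e).step) ^ C.q' * C.dC := by
    have h := sum_supp_sz_le h29 hC.E₃_nonneg (sh e)
    rwa [wt_kind2 hk] at h
  rw [mul_pow] at hfl hszs
  push_cast at hfl
  have hP : (1 : ℝ) ≤ R (sh e).step := by exact_mod_cast hR1 (sh e).step hsK
  have key := merge_arith (Lq := (L : ℝ) ^ C.q') (E₂ := C.E₂) (E₃ := C.E₃) (n₁ := (C.n₁ : ℝ)) (dC := (C.dC : ℝ))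
    hP (by positivity) hC.E₂_nonneg hC.E₃_nonneg (Nat.cast_nonneg _) (Nat.cast_nonneg _) C.q'
  have hpay := Hm (sh (absorbed X Y)).step (sh e).step hab.2 hsK
  push_cast
  linarith

/-- **THE TAGGED SHAPES INHABIT `Banking`.**  For valid constants, along a run obeying the typed (2.9) first member with
`1 ≤ R s`, the three scale-indexed pay inequalities make the tagged data — admissibility `ConsistentT sh`, windows
`dictWT sh`, cost `costT sh`, credit / bank / reserve read at the shape, extension `extnT sh` — satisfy all four binders of
`T4BankedInduction.Banking` over the label type `ε` (the merger geometry exactly).  `T4PrintedShapeBanking.banking_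
printedShape` is the case `ε = PEv`, `sh = id` (§7). [folklore] -/
theorem banking_taggedShape (hC : C.Valid) (h29 : B14FlowStep.FlowIneq29 R g L β' β₀ K) (hL : 1 ≤ L)
    (hR1 : ∀ s, s ≤ K → 1 ≤ R s)
    (Hb : ∀ s, s ≤ K → ∀ d' : ℕ,
      (C.Eb + C.μ + (3 * C.E₂ * (L : ℝ) ^ C.q' + C.E₃ * (L : ℝ) ^ C.q' + 3 * C.κ₁) * (R s : ℝ) ^ (C.q' + 1)) *
          ((d' : ℝ) + 1) + 2 * p0Profile C.A₀ C.p₀ (g s) ≤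
        C.a * (p0Profile C.A₀ C.p₀ (g s)) ^ 2 * ((d' : ℝ) + 1) + 2 * p0Profile C.A₀ C.p₀ (g s))
    (Hr : ∀ h, h + 1 ≤ K →
      2 * C.E₂ * (L : ℝ) ^ C.q' * (R (h + 1) : ℝ) ^ (C.q' + 1) + (C.κ₁ * ((R (h + 1) : ℝ) + 1) + C.E₀) ≤
        p0Profile C.A₀ C.p₀ (g h))
    (Hm : ∀ m s, m ≤ s → s ≤ K →
      ((1 + C.n₁) * C.E₂ * (L : ℝ) ^ C.q' + C.dC * C.E₃ * (L : ℝ) ^ C.q') * (R s : ℝ) ^ (C.q' + 1) +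
          (C.κ₁ * ((C.n₁ : ℝ) + R s) + C.E₀) ≤ 2 * p0Profile C.A₀ C.p₀ (g m)) :
    Banking (ConsistentT sh C K R) (dictWT sh R C.n₁) (costT sh C K R) (credit C g ∘ sh)
      (fun e => C.κ₁ * ((dictWT sh R C.n₁ e : ℕ) : ℝ) + Emarg C (sh e)) (reserve C g ∘ sh) (extnT sh C K R) where
  cost_nonneg := costT_nonneg hC.E₂_nonneg hC.E₃_nonneg
  adm_renew G e h hc := by
    simp only [ConsistentT] at hc
    exact hc.1
  adm_merge X Y e hc := by
    simp only [ConsistentT] at hc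
    exact ⟨hc.1, hc.2.1⟩
  born b j hc := bornT_holds hC h29 hL hR1 Hb b j hc
  renew_past G e h hc hW n hn := (renewT_past_eq G e h hc hW n hn).le
  renew G e h hc hW := renewT_holds hC h29 hL hR1 Hr G e h hc hW
  merge_geom X Y e hc hW := (lifeCostT_merge_eq hC X Y e hc hW).le
  merge_pay X Y e hc _ := mergeT_pay_holds hC h29 hL hR1 Hm X Y e hc

end InhabitT

/-! ## §4 The pay side is label-free: the three pay inequalities from the typed flow, ONE threshold, every label type -/

section Pay

variable {C : T4PrintedShapeBanking.Consts} {K L r : ℕ} {R : ℕ → ℕ} {g : ℕ → ℝ} {β' β₀ : ℝ}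

/-- **THE THREE SCALE-INDEXED PAY INEQUALITIES FROM THE TYPED FLOW** — the arithmetic inside
`T4PrintedShapeBanking.banking_printedShape_of_flow`, stated ONCE with no label type in sight: typed (2.7), typed (2.5)
along the run, `r ≤ p₀`, `r(q′+1) ≤ p₀`, `L ≥ 1`, `β₀ ≥ 0`, `1 ≤ log g_s⁻²`, and on the infrared value `log g_K⁻²` two
γ-clauses per case with budgets `(1+β₀)(c₁+c₂) ≤ 1`, `(1+β₀)(c₃+c₄) ≤ 2` and the birth threshold `(1+β₀)(c₅+c₆) ≤
a·p₀(g_K)` give the birth, renewal and merger pay inequalities (`birthFactor_pays`, `renewalFactor_pays`,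
`mergeSurplus_pays` by name). [folklore] -/
theorem payIneqs_of_flow {c₁ c₂ c₃ c₄ c₅ c₆ : ℝ} (hC : C.Valid) (ha : 0 ≤ C.a) (hA : 0 ≤ C.A₀)
    (h27 : B14.FlowIneq27 g β' β₀ C.p₀ K)
    (hR : ∀ s, s ≤ K → B14.IsRj L r (g s) (R s))
    (hrp : r ≤ C.p₀) (hrq : r * (C.q' + 1) ≤ C.p₀) (hL : 1 ≤ L) (hβ : 0 ≤ β₀)
    (hc₁ : 0 ≤ c₁) (hc₂ : 0 ≤ c₂) (hc₃ : 0 ≤ c₃) (hc₄ : 0 ≤ c₄) (hc₅ : 0 ≤ c₅) (hc₆ : 0 ≤ c₆)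
    (hx1 : ∀ s, s ≤ K → 1 ≤ Real.log ((g s) ^ 2)⁻¹)
    (hγ₁ : (L : ℝ) * (1 + β₀) * (2 * C.κ₁ + C.E₀) ≤ c₁ * C.A₀ * (Real.log ((g K) ^ 2)⁻¹) ^ (C.p₀ - r))
    (hγ₂ : (L : ℝ) ^ (C.q' + 1) * (1 + β₀) * (2 * C.E₂ * (L : ℝ) ^ C.q') ≤
      c₂ * C.A₀ * (Real.log ((g K) ^ 2)⁻¹) ^ (C.p₀ - r * (C.q' + 1)))
    (hb₁ : (1 + β₀) * (c₁ + c₂) ≤ 1)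
    (hγ₃ : (L : ℝ) * (1 + β₀) * ((1 + (C.n₁ : ℝ)) * C.κ₁ + C.E₀) ≤
      c₃ * C.A₀ * (Real.log ((g K) ^ 2)⁻¹) ^ (C.p₀ - r))
    (hγ₄ : (L : ℝ) ^ (C.q' + 1) * (1 + β₀) * ((1 + C.n₁) * C.E₂ * (L : ℝ) ^ C.q' + C.dC * C.E₃ * (L : ℝ) ^ C.q') ≤
      c₄ * C.A₀ * (Real.log ((g K) ^ 2)⁻¹) ^ (C.p₀ - r * (C.q' + 1)))
    (hb₂ : (1 + β₀) * (c₃ + c₄) ≤ 2)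
    (hγ₅ : (L : ℝ) * (1 + β₀) * (C.Eb + C.μ) ≤ c₅ * C.A₀ * (Real.log ((g K) ^ 2)⁻¹) ^ (C.p₀ - r))
    (hγ₆ : (L : ℝ) ^ (C.q' + 1) * (1 + β₀) * (3 * C.E₂ * (L : ℝ) ^ C.q' + C.E₃ * (L : ℝ) ^ C.q' + 3 * C.κ₁) ≤
      c₆ * C.A₀ * (Real.log ((g K) ^ 2)⁻¹) ^ (C.p₀ - r * (C.q' + 1)))
    (hthr : (1 + β₀) * (c₅ + c₆) ≤ C.a * p0Profile C.A₀ C.p₀ (g K)) :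
    (∀ s, s ≤ K → ∀ d' : ℕ,
      (C.Eb + C.μ + (3 * C.E₂ * (L : ℝ) ^ C.q' + C.E₃ * (L : ℝ) ^ C.q' + 3 * C.κ₁) * (R s : ℝ) ^ (C.q' + 1)) *
          ((d' : ℝ) + 1) + 2 * p0Profile C.A₀ C.p₀ (g s) ≤
        C.a * (p0Profile C.A₀ C.p₀ (g s)) ^ 2 * ((d' : ℝ) + 1) + 2 * p0Profile C.A₀ C.p₀ (g s)) ∧
    (∀ h, h + 1 ≤ K →
      2 * C.E₂ * (L : ℝ) ^ C.q' * (R (h + 1) : ℝ) ^ (C.q' + 1) + (C.κ₁ * ((R (h + 1) : ℝ) + 1) + C.E₀) ≤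
        p0Profile C.A₀ C.p₀ (g h)) ∧
    (∀ m s, m ≤ s → s ≤ K →
      ((1 + C.n₁) * C.E₂ * (L : ℝ) ^ C.q' + C.dC * C.E₃ * (L : ℝ) ^ C.q') * (R s : ℝ) ^ (C.q' + 1) +
          (C.κ₁ * ((C.n₁ : ℝ) + R s) + C.E₀) ≤ 2 * p0Profile C.A₀ C.p₀ (g m)) := by
  have hR1 := one_le_R hR hL
  have hx0 : ∀ s, s ≤ K → 0 ≤ Real.log ((g s) ^ 2)⁻¹ := fun s hs => by linarith [hx1 s hs]
  refine ⟨?_, ?_, ?_⟩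
  · -- births: `credit_dominates_window_poly` (κ₁ := 0) feeds `birthFactor_pays`
    have hpoly : ∀ s, s ≤ K →
        C.Eb + C.μ + (3 * C.E₂ * (L : ℝ) ^ C.q' + C.E₃ * (L : ℝ) ^ C.q' + 3 * C.κ₁) * (R s : ℝ) ^ (C.q' + 1) ≤
          (c₅ + c₆) * p0Profile C.A₀ C.p₀ (g s) := by
      intro s hs
      have h := credit_dominates_window_poly (κ₁ := 0) (F := 0) (W := R) (E₀ := C.Eb + C.μ)
        (E₁ := 3 * C.E₂ * (L : ℝ) ^ C.q' + C.E₃ * (L : ℝ) ^ C.q' + 3 * C.κ₁) (q := C.q' + 1)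
        h27 hR hrp hrq hL hβ hA hc₅ hc₆ (add_nonneg hC.Eb_nonneg hC.μ_nonneg) le_rfl hx1
        (fun s _ => by simp) (by simpa using hγ₅) hγ₆ s hs
      linarith
    exact birthFactor_pays (E_f := C.Eb) (μ := C.μ) h27 hβ hA ha hx0 hpoly hthr
  · -- renewals
    have hW : ∀ s, s ≤ K → (((fun s => R s + 1) s : ℕ) : ℝ) ≤ (1 + 1) * R s := by
      intro s hs
      have : (1 : ℝ) ≤ R s := by exact_mod_cast hR1 s hs
      push_cast
      linarith
    have hγ₁' : (L : ℝ) * (1 + β₀) * ((1 + 1) * C.κ₁ + C.E₀) ≤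
        c₁ * C.A₀ * (Real.log ((g K) ^ 2)⁻¹) ^ (C.p₀ - r) := by
      rw [one_add_one_eq_two]; exact hγ₁
    have h := renewalFactor_pays (W := fun s => R s + 1) (F := 1) (E₁ := 2 * C.E₂ * (L : ℝ) ^ C.q')
      (q := C.q' + 1) h27 hR hrp hrq hL hβ hA hc₁ hc₂ hC.E₀_nonneg hC.κ₁_nonneg hx1 hW hγ₁' hγ₂ hb₁
    intro k hk
    have := h k hk
    push_cast at this
    linarith
  · -- mergers
    have hW : ∀ s, s ≤ K → (((fun s => C.n₁ + R s) s : ℕ) : ℝ) ≤ (1 + (C.n₁ : ℝ)) * R s := by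
      intro s hs
      have : (1 : ℝ) ≤ R s := by exact_mod_cast hR1 s hs
      have hn : (0 : ℝ) ≤ C.n₁ := Nat.cast_nonneg _
      push_cast
      nlinarith
    have h := mergeSurplus_pays (W := fun s => C.n₁ + R s) (F := (C.n₁ : ℝ))
      (E₁ := (1 + C.n₁) * C.E₂ * (L : ℝ) ^ C.q' + C.dC * C.E₃ * (L : ℝ) ^ C.q') (q := C.q' + 1)
      h27 hR hrp hrq hL hβ hA hc₃ hc₄ hC.E₀_nonneg hC.κ₁_nonneg hx1 hW hγ₃ hγ₄ hb₂
    intro m s hms hs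
    have := h m s hms hs
    push_cast at this
    linarith

end Pay

section Threshold

/-- **ONE INFRARED THRESHOLD FOR THE PAY SIDE, constants only** — the number `x₀` of
`T4PrintedShapeBanking.exists_irThreshold`, extracted: for valid symbolic constants with `a, A₀ > 0`, `L ≥ 1`, `β₀ ≥ 0`,
`r(q′+1) < p₀` there is `x₀` such that along EVERY run of the typed flow ((2.7), (2.5), `1 ≤ log g_s⁻²`) whose infrared
value has `x₀ ≤ log g_K⁻²`, the three scale-indexed pay inequalities hold.  No label type, no cutoff dependence.
[folklore] -/
theorem exists_payThreshold (C : T4PrintedShapeBanking.Consts) (hC : C.Valid) (ha : 0 < C.a) (hA : 0 < C.A₀)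
    {L r : ℕ} (hL : 1 ≤ L) {β₀ : ℝ} (hβ : 0 ≤ β₀) (hrq : r * (C.q' + 1) < C.p₀) :
    ∃ x₀ : ℝ, ∀ (K : ℕ) (R : ℕ → ℕ) (g : ℕ → ℝ) (β' : ℝ),
      B14.FlowIneq27 g β' β₀ C.p₀ K → (∀ s, s ≤ K → B14.IsRj L r (g s) (R s)) →
      (∀ s, s ≤ K → 1 ≤ Real.log ((g s) ^ 2)⁻¹) → x₀ ≤ Real.log ((g K) ^ 2)⁻¹ →
      (∀ s, s ≤ K → ∀ d' : ℕ,
        (C.Eb + C.μ + (3 * C.E₂ * (L : ℝ) ^ C.q' + C.E₃ * (L : ℝ) ^ C.q' + 3 * C.κ₁) * (R s : ℝ) ^ (C.q' + 1)) *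
            ((d' : ℝ) + 1) + 2 * p0Profile C.A₀ C.p₀ (g s) ≤
          C.a * (p0Profile C.A₀ C.p₀ (g s)) ^ 2 * ((d' : ℝ) + 1) + 2 * p0Profile C.A₀ C.p₀ (g s)) ∧
      (∀ h, h + 1 ≤ K →
        2 * C.E₂ * (L : ℝ) ^ C.q' * (R (h + 1) : ℝ) ^ (C.q' + 1) + (C.κ₁ * ((R (h + 1) : ℝ) + 1) + C.E₀) ≤
          p0Profile C.A₀ C.p₀ (g h)) ∧
      (∀ m s, m ≤ s → s ≤ K →
        ((1 + C.n₁) * C.E₂ * (L : ℝ) ^ C.q' + C.dC * C.E₃ * (L : ℝ) ^ C.q') * (R s : ℝ) ^ (C.q' + 1) +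
            (C.κ₁ * ((C.n₁ : ℝ) + R s) + C.E₀) ≤ 2 * p0Profile C.A₀ C.p₀ (g m)) := by
  have hrp : r < C.p₀ := lt_of_le_of_lt (Nat.le_mul_of_pos_right r (Nat.succ_pos _)) hrq
  have hb0 : (0 : ℝ) < 1 + β₀ := by linarith
  have hcR : 0 < 1 / (2 * (1 + β₀)) * C.A₀ := by positivity
  have hcM : 0 < 1 / (1 + β₀) * C.A₀ := by positivity
  have hc1 : 0 < (1 : ℝ) * C.A₀ := by simpa using hA
  obtain ⟨x₁, hx₁⟩ := exists_threshold_poly (β₀ := β₀) (F := 1) (E₀ := C.E₀)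
    (E₁ := 2 * C.E₂ * (L : ℝ) ^ C.q') (κ₁ := C.κ₁) (L := L) (q := C.q' + 1) hrp hrq hcR hcR
  obtain ⟨x₂, hx₂⟩ := exists_threshold_poly (β₀ := β₀) (F := (C.n₁ : ℝ)) (E₀ := C.E₀)
    (E₁ := (1 + C.n₁) * C.E₂ * (L : ℝ) ^ C.q' + C.dC * C.E₃ * (L : ℝ) ^ C.q') (κ₁ := C.κ₁) (L := L)
    (q := C.q' + 1) hrp hrq hcM hcM
  obtain ⟨x₃, hx₃⟩ := exists_threshold_poly (β₀ := β₀) (F := 0) (E₀ := C.Eb + C.μ)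
    (E₁ := 3 * C.E₂ * (L : ℝ) ^ C.q' + C.E₃ * (L : ℝ) ^ C.q' + 3 * C.κ₁) (κ₁ := 0) (L := L)
    (q := C.q' + 1) hrp hrq hc1 hc1
  refine ⟨max (max x₁ x₂) (max x₃ (max 1 (2 * (1 + β₀) / (C.a * C.A₀)))), ?_⟩
  intro K R g β' h27 hR hx1 hxK
  have hK₁ : x₁ ≤ Real.log ((g K) ^ 2)⁻¹ := le_trans ((le_max_left _ _).trans (le_max_left _ _)) hxK
  have hK₂ : x₂ ≤ Real.log ((g K) ^ 2)⁻¹ := le_trans ((le_max_right _ _).trans (le_max_left _ _)) hxK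
  have hK₃ : x₃ ≤ Real.log ((g K) ^ 2)⁻¹ := le_trans ((le_max_left _ _).trans (le_max_right _ _)) hxK
  have hK₄ : max 1 (2 * (1 + β₀) / (C.a * C.A₀)) ≤ Real.log ((g K) ^ 2)⁻¹ :=
    le_trans ((le_max_right _ _).trans (le_max_right _ _)) hxK
  obtain ⟨hγ₁, hγ₂⟩ := hx₁ _ hK₁
  obtain ⟨hγ₃, hγ₄⟩ := hx₂ _ hK₂
  obtain ⟨hγ₅, hγ₆⟩ := hx₃ _ hK₃
  have hthr : (1 + β₀) * (1 + 1) ≤ C.a * p0Profile C.A₀ C.p₀ (g K) := by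
    have h := gammaClause_of_large (B := 2 * (1 + β₀)) (n := C.p₀) (mul_pos ha hA) (by omega) hK₄
    unfold p0Profile
    linarith
  have hb₁ : (1 + β₀) * (1 / (2 * (1 + β₀)) + 1 / (2 * (1 + β₀))) ≤ 1 := by
    rw [show (1 + β₀) * (1 / (2 * (1 + β₀)) + 1 / (2 * (1 + β₀))) = 1 by field_simp; ring]
  have hb₂ : (1 + β₀) * (1 / (1 + β₀) + 1 / (1 + β₀)) ≤ 2 := by
    rw [show (1 + β₀) * (1 / (1 + β₀) + 1 / (1 + β₀)) = 2 by field_simp; ring]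
  have hγ₁' : (L : ℝ) * (1 + β₀) * (2 * C.κ₁ + C.E₀) ≤
      1 / (2 * (1 + β₀)) * C.A₀ * (Real.log ((g K) ^ 2)⁻¹) ^ (C.p₀ - r) := by
    have e2 : ((1 : ℝ) + 1) * C.κ₁ = 2 * C.κ₁ := by norm_num
    rw [e2] at hγ₁
    exact hγ₁
  have hγ₅' : (L : ℝ) * (1 + β₀) * (C.Eb + C.μ) ≤ 1 * C.A₀ * (Real.log ((g K) ^ 2)⁻¹) ^ (C.p₀ - r) := by
    simpa using hγ₅
  exact payIneqs_of_flow hC ha.le hA.le h27 hR hrp.le hrq.le hL hβ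
    (by positivity) (by positivity) (by positivity) (by positivity) zero_le_one zero_le_one hx1
    hγ₁' hγ₂ hb₁ hγ₃ hγ₄ hb₂ hγ₅' hγ₆ hthr

/-- The untagged `Banking` instance of `T4PrintedShapeBanking` from the pay threshold, for the record: the SAME `x₀` serves
`banking_printedShape` (this is `exists_irThreshold` again, through `exists_payThreshold`). [folklore] -/
theorem banking_printedShape_of_payThreshold (C : T4PrintedShapeBanking.Consts) (hC : C.Valid) (ha : 0 < C.a)
    (hA : 0 < C.A₀) {L r : ℕ} (hL : 1 ≤ L) {β₀ : ℝ} (hβ : 0 ≤ β₀) (hrq : r * (C.q' + 1) < C.p₀) :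
    ∃ x₀ : ℝ, ∀ (K : ℕ) (R : ℕ → ℕ) (g : ℕ → ℝ) (β' : ℝ),
      B14.FlowIneq27 g β' β₀ C.p₀ K → B14FlowStep.FlowIneq29 R g L β' β₀ K →
      (∀ s, s ≤ K → B14.IsRj L r (g s) (R s)) → (∀ s, s ≤ K → 1 ≤ Real.log ((g s) ^ 2)⁻¹) →
      x₀ ≤ Real.log ((g K) ^ 2)⁻¹ →
        Banking (Consistent C K R) (dictW R C.n₁) (cost C K R) (credit C g)
          (fun e => C.κ₁ * ((dictW R C.n₁ e : ℕ) : ℝ) + Emarg C e) (reserve C g) (extn C K R) := by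
  obtain ⟨x₀, hx₀⟩ := exists_payThreshold C hC ha hA hL hβ hrq
  refine ⟨x₀, fun K R g β' h27 h29 hR hx1 hxK => ?_⟩
  obtain ⟨Hb, Hr, Hm⟩ := hx₀ K R g β' h27 hR hx1 hxK
  exact banking_printedShape hC h29 hL (one_le_R hR hL) Hb Hr Hm

variable {ε : Type*} [DecidableEq ε]

/-- **ONE INFRARED THRESHOLD, EVERY CUTOFF, EVERY LABEL TYPE**: for valid symbolic constants with `a, A₀ > 0`, `L ≥ 1`,
`β₀ ≥ 0`, `r(q′+1) < p₀` there is a number `x₀` — constants only, the one of `exists_payThreshold` — such that along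
EVERY run of the typed flow ((2.7), (2.9), (2.5), `1 ≤ log g_s⁻²`) with `x₀ ≤ log g_K⁻²` the tagged data of EVERY shape
map `sh : ε → PEv` inhabit `Banking (ConsistentT sh C K R) (dictWT sh R C.n₁) …`. [folklore] -/
theorem exists_irThresholdT (sh : ε → PEv) (C : T4PrintedShapeBanking.Consts) (hC : C.Valid) (ha : 0 < C.a)
    (hA : 0 < C.A₀) {L r : ℕ} (hL : 1 ≤ L) {β₀ : ℝ} (hβ : 0 ≤ β₀) (hrq : r * (C.q' + 1) < C.p₀) :
    ∃ x₀ : ℝ, ∀ (K : ℕ) (R : ℕ → ℕ) (g : ℕ → ℝ) (β' : ℝ),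
      B14.FlowIneq27 g β' β₀ C.p₀ K → B14FlowStep.FlowIneq29 R g L β' β₀ K →
      (∀ s, s ≤ K → B14.IsRj L r (g s) (R s)) → (∀ s, s ≤ K → 1 ≤ Real.log ((g s) ^ 2)⁻¹) →
      x₀ ≤ Real.log ((g K) ^ 2)⁻¹ →
        Banking (ConsistentT sh C K R) (dictWT sh R C.n₁) (costT sh C K R) (credit C g ∘ sh)
          (fun e => C.κ₁ * ((dictWT sh R C.n₁ e : ℕ) : ℝ) + Emarg C (sh e)) (reserve C g ∘ sh) (extnT sh C K R) := by
  obtain ⟨x₀, hx₀⟩ := exists_payThreshold C hC ha hA hL hβ hrq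
  refine ⟨x₀, fun K R g β' h27 h29 hR hx1 hxK => ?_⟩
  obtain ⟨Hb, Hr, Hm⟩ := hx₀ K R g β' h27 hR hx1 hxK
  exact banking_taggedShape hC h29 hL (one_le_R hR hL) Hb Hr Hm

end Threshold

/-! ## §5 The price of a consistent well-formed tagged genealogy -/

section PriceT

variable {ε : Type*} [DecidableEq ε] {sh : ε → PEv} {C : T4PrintedShapeBanking.Consts} {K : ℕ} {R : ℕ → ℕ}
  {g : ℕ → ℝ}

/-- **EVERY CONSISTENT WELL-FORMED TAGGED GENEALOGY OBEYS THE CARRIER'S PRICE SHAPE**: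
`e^{−credits}·e^{+lifeCost} ≤ e^{−(reserve + E)(sh root)}·e^{−κ₁ dictWT root}·∏_{e ∈ events ∖ root}(e^{−κ₁ dictWT e}·
e^{−E (sh e)})` — `T4BankedInduction.rawFactor_le_recordPrice` (generic in the label type), by name. [folklore] -/
theorem taggedShape_recordPrice
    (B : Banking (ConsistentT sh C K R) (dictWT sh R C.n₁) (costT sh C K R) (credit C g ∘ sh)
      (fun e => C.κ₁ * ((dictWT sh R C.n₁ e : ℕ) : ℝ) + Emarg C (sh e)) (reserve C g ∘ sh) (extnT sh C K R))
    {G : Gen ε} (hc : ConsistentT sh C K R G) (hW : G.WF (dictWT sh R C.n₁)) :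
    Real.exp (-credits (credit C g ∘ sh) G) * Real.exp (lifeCost (dictWT sh R C.n₁) (costT sh C K R) G) ≤
      (Real.exp (-(reserve C g (sh G.root) + Emarg C (sh G.root))) *
          Real.exp (-(C.κ₁ * ((dictWT sh R C.n₁ G.root : ℕ) : ℝ)))) *
        ∏ e ∈ G.events.erase G.root,
          (Real.exp (-(C.κ₁ * ((dictWT sh R C.n₁ e : ℕ) : ℝ))) * Real.exp (-Emarg C (sh e))) :=
  rawFactor_le_recordPrice B hc hW

/-- … in the currency of the count: `e^{−credits}·e^{+lifeCost} ≤ (rho C g ∘ sh) root·e^{−κ₁ dictWT root}·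
∏_{events ∖ root}(e^{−κ₁ dictWT e}·(eta C ∘ sh) e)`. [folklore] -/
theorem rawFactor_le_shapeT
    (B : Banking (ConsistentT sh C K R) (dictWT sh R C.n₁) (costT sh C K R) (credit C g ∘ sh)
      (fun e => C.κ₁ * ((dictWT sh R C.n₁ e : ℕ) : ℝ) + Emarg C (sh e)) (reserve C g ∘ sh) (extnT sh C K R))
    {G : Gen ε} (hc : ConsistentT sh C K R G) (hW : G.WF (dictWT sh R C.n₁)) :
    Real.exp (-credits (credit C g ∘ sh) G) * Real.exp (lifeCost (dictWT sh R C.n₁) (costT sh C K R) G) ≤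
      (rho C g ∘ sh) G.root * Real.exp (-(C.κ₁ * ((dictWT sh R C.n₁ G.root : ℕ) : ℝ))) *
        ∏ e ∈ G.events.erase G.root, (Real.exp (-(C.κ₁ * ((dictWT sh R C.n₁ e : ℕ) : ℝ))) * (eta C ∘ sh) e) := by
  have hp := taggedShape_recordPrice B hc hW
  simpa only [Function.comp_apply, rho_eq, eta_eq] using hp

omit [DecidableEq ε] in
/-- the root's price is the birth price of the model: `reserve + E = 2p₀(g_{rootStep}) + Eb + μ(d′+1)` at the root's
shape. [folklore] -/
theorem root_priceT {G : Gen ε} (hc : ConsistentT sh C K R G) :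
    reserve C g (sh G.root) + Emarg C (sh G.root) =
      2 * p0Profile C.A₀ C.p₀ (g G.rootStep) + (C.Eb + C.μ * (((sh G.root).fat : ℝ) + 1)) := by
  have h := ConsistentT.root_spec hc
  rw [reserve_kind0 h.1, Emarg_kind0 h.1, h.2]

omit [DecidableEq ε] in
/-- **CONSISTENT ⇒ PARTNER AGES ≤ SURPLUS** for tagged genealogies (steps read at the shape). [folklore] -/
theorem partnerAges_le_windowSurplusT :
    ∀ {G : Gen ε}, ConsistentT sh C K R G → partnerAges (PEv.step ∘ sh) G ≤ windowSurplus (dictWT sh R C.n₁) G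
  | Gen.born b j, _ => by simp
  | Gen.renew G e h, hc => by
      simp only [ConsistentT] at hc
      have ih := partnerAges_le_windowSurplusT hc.1
      simp only [partnerAges_renew, windowSurplus_renew]
      omega
  | Gen.merge X Y e, hc => by
      simp only [ConsistentT] at hc
      obtain ⟨hX, hY, -, h1, h2, h3, h4, -⟩ := hc
      have ihX := partnerAges_le_windowSurplusT hX
      have ihY := partnerAges_le_windowSurplusT hY
      simp only [partnerAges_merge, windowSurplus_merge, Function.comp_apply]
      omega

end PriceT

/-! ## §6 The seam: one tagged genealogy, the shape pull-back, one branching slot, and end to end -/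

section SeamT

variable {ε : Type*} [DecidableEq ε] {sh : ε → PEv} {C : T4PrintedShapeBanking.Consts} {K : ℕ} {R : ℕ → ℕ}
  {g : ℕ → ℝ}

/-- **THE SEAM, ONE TAGGED GENEALOGY**: if the tagged shapes inhabit `Banking` at cutoff `K` along `(R, g)`, `0 ≤ C.κ₁`,
`0 ≤ Λ′`, then a price `y` that is either `≤ 0` or at most `Λ′^{partnerAges}` times the raw factor of a CONSISTENT,
well-formed tagged genealogy `G` pending at `K` obeys `y ≤ e^{−C.κ₁ (K + 1 − rootStep G)}·treeWt (rho C g ∘ sh)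
(eta C ∘ sh) (Λ′e^{−C.κ₁}) (PEv.step ∘ sh) G` — the generic bridge `T4BranchingRecordsGas.treeShape_of_mulRawShape`
by name. [folklore] -/
theorem treeShape_of_labelBT (hκ : 0 ≤ C.κ₁)
    (hBk : Banking (ConsistentT sh C K R) (dictWT sh R C.n₁) (costT sh C K R) (credit C g ∘ sh)
      (fun e => C.κ₁ * ((dictWT sh R C.n₁ e : ℕ) : ℝ) + Emarg C (sh e)) (reserve C g ∘ sh) (extnT sh C K R))
    {Λ' : ℝ} (hΛ0 : 0 ≤ Λ') {y : ℝ} {G : Gen ε}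
    (hlab : y ≤ 0 ∨ (ConsistentT sh C K R G ∧ G.WF (dictWT sh R C.n₁) ∧ K < G.reach (dictWT sh R C.n₁) ∧
      y ≤ Λ' ^ partnerAges (PEv.step ∘ sh) G *
        (Real.exp (-credits (credit C g ∘ sh) G) * Real.exp (lifeCost (dictWT sh R C.n₁) (costT sh C K R) G)))) :
    y ≤ Real.exp (-(C.κ₁ * ((K + 1 - G.rootStep : ℕ) : ℝ))) *
      treeWt (rho C g ∘ sh) (eta C ∘ sh) (Λ' * Real.exp (-C.κ₁)) (PEv.step ∘ sh) G := by
  rcases hlab with h | ⟨hc, hW, hK, hy⟩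
  · exact h.trans (mul_nonneg (Real.exp_pos _).le (treeWt_nonneg (fun b => (rho_pos C g (sh b)).le)
      (fun e => (eta_pos C (sh e)).le) (mul_nonneg hΛ0 (Real.exp_pos _).le) (PEv.step ∘ sh) G))
  · exact treeShape_of_mulRawShape (ρ := rho C g ∘ sh) (η := eta C ∘ sh) (st := PEv.step ∘ sh) hκ hΛ0 hW
      (rho_pos C g (sh G.root)).le (fun e => eta_pos C (sh e)) hK (partnerAges_le_windowSurplusT hc)
      (hy.trans (mul_le_mul_of_nonneg_left (rawFactor_le_shapeT hBk hc hW) (pow_nonneg hΛ0 _)))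

omit [DecidableEq ε] in
/-- **THE TREE WEIGHT OF THE MODEL IS READ OFF THE SHAPES OF THE TAGS**:
`treeWt (rho C g) (eta C) θ PEv.step (relabel (shape ∘ sh) G) = treeWt (rho C g ∘ sh) (eta C ∘ sh) θ (PEv.step ∘ sh) G`
(`treeWt_relabel` + `rho_shape`, `eta_shape`, `step_shape`). [folklore] -/
theorem treeWt_relabel_shapeT (sh : ε → PEv) (C : T4PrintedShapeBanking.Consts) (g : ℕ → ℝ) (θ : ℝ) (G : Gen ε) :
    treeWt (rho C g) (eta C) θ PEv.step (relabel (shape ∘ sh) G) =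
      treeWt (rho C g ∘ sh) (eta C ∘ sh) θ (PEv.step ∘ sh) G := by
  rw [treeWt_relabel (shape ∘ sh) (rho C g) (eta C) θ (st := PEv.step ∘ sh) (st' := PEv.step)
    (fun e => step_shape (sh e))]
  simp only [Function.comp_def, rho_shape, eta_shape]

/-- the window depends only on the shape [folklore] -/
theorem dictW_shape (R : ℕ → ℕ) (n₁ : ℕ) (e : PEv) : dictW R n₁ (shape e) = dictW R n₁ e := by
  unfold dictW
  simp only [kind_shape, step_shape]
  split_ifs with h <;> simp [fat_shape_of_kind0, *]

omit [DecidableEq ε] in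
/-- relabelling by the shape of the tag keeps the reach of the tagged table [folklore] -/
theorem reach_relabel_shapeT (sh : ε → PEv) (R : ℕ → ℕ) (n₁ : ℕ) (G : Gen ε) :
    (relabel (shape ∘ sh) G).reach (dictW R n₁) = G.reach (dictWT sh R n₁) :=
  reach_relabel (shape ∘ sh) (W := dictWT sh R n₁) (W' := dictW R n₁)
    (fun e => by simp only [Function.comp_apply, dictWT_apply, dictW_shape]) G

/-- **THE SEAM, ONE BRANCHING SLOT** — the labelling binder `hlabT` at one slot: the price at the branching record `G` (a
genealogy term over SHAPES) is either `≤ 0` or at most `Λ′^{partnerAges G̃}` × the raw factor of SOME consistent,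
well-formed TAGGED genealogy `G̃ : Gen ε`, pending at `K`, whose shape-relabelling `relabel (shape ∘ sh) G̃` is `G`; then
`y ≤ e^{−C.κ₁ (K + 1 − rootStep G)}·treeWt (rho C g) (eta C) (Λ′e^{−C.κ₁}) PEv.step G`. [folklore] -/
theorem treeShape_of_labelT (hκ : 0 ≤ C.κ₁)
    (hBk : Banking (ConsistentT sh C K R) (dictWT sh R C.n₁) (costT sh C K R) (credit C g ∘ sh)
      (fun e => C.κ₁ * ((dictWT sh R C.n₁ e : ℕ) : ℝ) + Emarg C (sh e)) (reserve C g ∘ sh) (extnT sh C K R))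
    {Λ' : ℝ} (hΛ0 : 0 ≤ Λ') {y : ℝ} {G : Gen PEv}
    (hlabT : y ≤ 0 ∨ ∃ G' : Gen ε, ConsistentT sh C K R G' ∧ G'.WF (dictWT sh R C.n₁) ∧
      K < G'.reach (dictWT sh R C.n₁) ∧ relabel (shape ∘ sh) G' = G ∧
      y ≤ Λ' ^ partnerAges (PEv.step ∘ sh) G' *
        (Real.exp (-credits (credit C g ∘ sh) G') * Real.exp (lifeCost (dictWT sh R C.n₁) (costT sh C K R) G'))) :
    y ≤ Real.exp (-(C.κ₁ * ((K + 1 - G.rootStep : ℕ) : ℝ))) *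
      treeWt (rho C g) (eta C) (Λ' * Real.exp (-C.κ₁)) PEv.step G := by
  rcases hlabT with h | ⟨G', hc, hW, hK, hG, hy⟩
  · exact h.trans (mul_nonneg (Real.exp_pos _).le (treeWt_nonneg (fun b => (rho_pos C g b).le)
      (fun e => (eta_pos C e).le) (mul_nonneg hΛ0 (Real.exp_pos _).le) PEv.step G))
  · have h := treeShape_of_labelBT hκ hBk hΛ0 (Or.inr ⟨hc, hW, hK, hy⟩)
    rw [← hG, rootStep_relabel, treeWt_relabel_shapeT]
    exact h

end SeamT

section EndToEndT

variable {ε γ κ ι : Type*} [DecidableEq ε] [DecidableEq γ] [DecidableEq κ] {l₀ : ℝ} {K₀ : ℕ} {π : ℕ → ι → κ}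
  {T : ℕ → Finset ι} {A A' : ℕ → ℝ → ι → ℝ} {Bad' : ℕ → ℝ → Finset κ} {dead dead' : ℕ → ℝ → ι → ℝ}
  {F Rf F' Rf' : ℕ → κ → ℝ} {nlow nup mlow mup : ℕ → ℝ → ℝ} {Cn : ℝ}

/-- **`Banking` OF THE TAGGED SHAPES ALONG A FAMILY OF RUNS + PRICES LABELLED BY TAGGED GENEALOGIES OVER BRANCHING
RECORDS + THE BRANCHING RECORDS GAS ⇒ THE WEIGHT SLOT.**  `T4BranchingRecordsGas.exists_relWeightBound_of_bankingB`
with the labelling binder `hlabB ↦ hlabT` (one slot: `treeShape_of_labelT`) and `hBk` the tagged instance; the count side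
— cells, menus `Lroot Lren Lmer Lpart`, fuel `Ncap`, budgets `ρ̄, a, μ, ν`, age datum `Λ′`, root rate
`Λ·e^{η̄₊ − C.κ₁} < 1`, slots, `Regeneration` runs, conclusion `∃ K₁ ≥ K₀, RelWeightBound …` with budget
`𝟙·C·recordsBudget ρ̄ C.κ₁ V Λ η̄₊ j⋆` — VERBATIM. [folklore] -/
theorem exists_relWeightBound_of_bankingT (sh : ε → PEv) {C : T4PrintedShapeBanking.Consts} (hκ : 0 ≤ C.κ₁)
    (R : ℕ → ℕ → ℕ) (g : ℕ → ℕ → ℝ)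
    (hBk : ∀ K, K₀ ≤ K → Banking (ConsistentT sh C K (R K)) (dictWT sh (R K) C.n₁) (costT sh C K (R K))
      (credit C (g K) ∘ sh) (fun e => C.κ₁ * ((dictWT sh (R K) C.n₁ e : ℕ) : ℝ) + Emarg C (sh e))
      (reserve C (g K) ∘ sh) (extnT sh C K (R K)))
    (Cell : ℕ → ℕ → Finset γ) {V Λ : ℝ} (hV : 0 ≤ V) (hΛ : 0 < Λ)
    (hcell : ∀ K a, ((Cell K a).card : ℝ) ≤ V * Λ ^ a)
    (Lren Lmer Lpart Lroot : ℕ → ℕ → Finset PEv) (Ncap : ℕ → ℕ)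
    (hst : ∀ K t, ∀ e ∈ Lmer K t, PEv.step e = t) {ρbar a μ ν ηplus : ℝ}
    (hρbar : ∀ K j, ∑ b ∈ Lroot K j, rho C (g K) b ≤ ρbar) (ha : ∀ K t, ∑ e ∈ Lren K t, eta C e ≤ a)
    (hμ : ∀ K t, ∑ e ∈ Lmer K t, eta C e ≤ μ) (hν : ∀ K s, ∑ b ∈ Lpart K s, eta C b ≤ ν) (hηplus : 0 ≤ ηplus)
    (hr : Λ * Real.exp (ηplus - C.κ₁) < 1) {Λ' : ℝ} (hΛ0 : 0 ≤ Λ')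
    (h1 : Λ' * Real.exp (-C.κ₁) * Real.exp ηplus < 1)
    (hx : (a + μ * ν * (Λ' * Real.exp (-C.κ₁) / (1 - Λ' * Real.exp (-C.κ₁) * Real.exp ηplus))) * Real.exp ηplus ≤
      Real.exp ηplus - 1)
    (jstar : ℕ → ℕ) (hj : ∀ K, jstar K ≤ K) {c : ℝ} (hc : 0 < c)
    (hfrac : ∀ K : ℕ, c * K ≤ ((K - jstar K : ℕ) : ℝ)) (y : ℕ → ℕ → γ → Gen PEv → ℝ)
    (hy0 : ∀ K, ∀ j ≤ K, ∀ z ∈ Cell K (K - j), ∀ G ∈ runFam Lren Lmer Lpart Lroot Ncap K j, 0 ≤ y K j z G)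
    (hlabT : ∀ K, K₀ ≤ K → ∀ j ≤ K, ∀ z ∈ Cell K (K - j), ∀ G ∈ runFam Lren Lmer Lpart Lroot Ncap K j,
      y K j z G ≤ 0 ∨ ∃ G' : Gen ε, ConsistentT sh C K (R K) G' ∧ G'.WF (dictWT sh (R K) C.n₁) ∧
        K < G'.reach (dictWT sh (R K) C.n₁) ∧ relabel (shape ∘ sh) G' = G ∧
        y K j z G ≤ Λ' ^ partnerAges (PEv.step ∘ sh) G' * (Real.exp (-credits (credit C (g K) ∘ sh) G') *
          Real.exp (lifeCost (dictWT sh (R K) C.n₁) (costT sh C K (R K)) G')))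
    (str : ℕ → κ → Finset (BSlot γ PEv))
    (hinj : ∀ K t, |t| ≤ l₀ → K₀ ≤ K → Set.InjOn (str K) (Bad' K t))
    (hstr : ∀ K t, |t| ≤ l₀ → K₀ ≤ K → ∀ c ∈ Bad' K t,
      str K c ⊆ bliveSlots Cell (runFam Lren Lmer Lpart Lroot Ncap) K ∧
        ∃ o ∈ boldSlots Cell (runFam Lren Lmer Lpart Lroot Ncap) jstar K, o ∈ str K c)
    (hA : Regeneration l₀ π T A Bad' dead F Rf nlow nup Cn K₀)
    (hA' : Regeneration l₀ π T A' Bad' dead' F' Rf' mlow mup Cn K₀)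
    (hF : ∀ K t, |t| ≤ l₀ → K₀ ≤ K → ∀ c ∈ Bad' K t, F K c * Rf K c ≤ famWeight (bslotPrice (y K)) (str K c))
    (hF' : ∀ K t, |t| ≤ l₀ → K₀ ≤ K → ∀ c ∈ Bad' K t, F' K c * Rf' K c ≤ famWeight (bslotPrice (y K)) (str K c))
    (hCn : 0 ≤ Cn) :
    ∃ K₁, K₀ ≤ K₁ ∧ RelWeightBound l₀ T A A' (fun K t => if K₁ ≤ K then badOfClass π T Bad' K t else ∅)
      (Set.indicator {K | K₁ ≤ K} (fun K => Cn * recordsBudget ρbar C.κ₁ V Λ ηplus jstar K)) :=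
  exists_relWeightBound_of_regeneration_branchingGasRun Cell hV hΛ hcell Lren Lmer Lpart Lroot Ncap PEv.step hst
    (fun K => rho C (g K)) (fun _ => eta C) (fun K b => (rho_pos C (g K) b).le) (fun _ e => (eta_pos C e).le) hρbar
    ha hμ hν (mul_nonneg hΛ0 (Real.exp_pos _).le) hηplus h1 hx hr jstar hj hc hfrac y hy0
    (fun K hK j hjK z hz G hG => by
      have h := treeShape_of_labelT hκ (hBk K hK) hΛ0 (hlabT K hK j hjK z hz G hG)
      rwa [rootStep_of_mem_fam (Lren := Lren K) (Lmer := Lmer K) (Lpart := Lpart K) (Ncap K) (Lroot K j) j K G hG] at h)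
    str hinj hstr hA hA' hF hF'  hCn

/-- **END TO END WITH TAGGED GENEALOGIES — ONE INFRARED THRESHOLD, THEN THE WEIGHT SLOT.**
`T4BranchingRecordsGas.exists_irThreshold_relWeightBoundB` with `hlabB ↦ hlabT`: for valid symbolic constants with
`a, A₀ > 0`, `L ≥ 1`, `β₀ ≥ 0`, `r(q′+1) < p₀` and every shape map `sh : ε → PEv` there is ONE number `x₀`
(`exists_irThresholdT`; constants only) such that for EVERY family of runs obeying typed (2.7), (2.9), (2.5),
`1 ≤ log g_{K,s}⁻²`, `x₀ ≤ log g_{K,K}⁻²` from `K₀` on, every menu datum with its four budgets, every age datum `Λ′ ≥ 0`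
with `Λ′e^{−C.κ₁}·e^{η̄₊} < 1` and the fixed-point side condition, the root rate `Λ·e^{η̄₊ − C.κ₁} < 1`, prices labelled
by TAGGED genealogies over branching records (`hlabT`) and two regeneration runs: `∃ K₁ ≥ K₀` with the kernel's term-level
`RelWeightBound`, budget `𝟙·C·recordsBudget ρ̄ C.κ₁ V Λ η̄₊ j⋆`.  The count member's chain as ONE statement; its binders
are the census of what is not kernel. [folklore] -/
theorem exists_irThreshold_relWeightBoundT (sh : ε → PEv) (C : T4PrintedShapeBanking.Consts) (hC : C.Valid)
    (ha₀ : 0 < C.a) (hA₀ : 0 < C.A₀) {L r : ℕ} (hL : 1 ≤ L) {β₀ : ℝ} (hβ : 0 ≤ β₀) (hrq : r * (C.q' + 1) < C.p₀)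
    (Cell : ℕ → ℕ → Finset γ) {V Λ : ℝ} (hV : 0 ≤ V) (hΛ : 0 < Λ)
    (hcell : ∀ K a, ((Cell K a).card : ℝ) ≤ V * Λ ^ a)
    (Lren Lmer Lpart Lroot : ℕ → ℕ → Finset PEv) (Ncap : ℕ → ℕ)
    (hst : ∀ K t, ∀ e ∈ Lmer K t, PEv.step e = t) (jstar : ℕ → ℕ) (hj : ∀ K, jstar K ≤ K) {c : ℝ} (hc : 0 < c)
    (hfrac : ∀ K : ℕ, c * K ≤ ((K - jstar K : ℕ) : ℝ))
    (hA : Regeneration l₀ π T A Bad' dead F Rf nlow nup Cn K₀)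
    (hA' : Regeneration l₀ π T A' Bad' dead' F' Rf' mlow mup Cn K₀) (hCn : 0 ≤ Cn) :
    ∃ x₀ : ℝ, ∀ (R : ℕ → ℕ → ℕ) (g : ℕ → ℕ → ℝ) (β' : ℕ → ℝ),
      (∀ K, K₀ ≤ K → B14.FlowIneq27 (g K) (β' K) β₀ C.p₀ K) →
      (∀ K, K₀ ≤ K → B14FlowStep.FlowIneq29 (R K) (g K) L (β' K) β₀ K) →
      (∀ K, K₀ ≤ K → ∀ s, s ≤ K → B14.IsRj L r (g K s) (R K s)) →
      (∀ K, K₀ ≤ K → ∀ s, s ≤ K → 1 ≤ Real.log ((g K s) ^ 2)⁻¹) →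
      (∀ K, K₀ ≤ K → x₀ ≤ Real.log ((g K K) ^ 2)⁻¹) →
      ∀ {ρbar a μ ν ηplus : ℝ}, (∀ K j, ∑ b ∈ Lroot K j, rho C (g K) b ≤ ρbar) →
      (∀ K t, ∑ e ∈ Lren K t, eta C e ≤ a) → (∀ K t, ∑ e ∈ Lmer K t, eta C e ≤ μ) →
      (∀ K s, ∑ b ∈ Lpart K s, eta C b ≤ ν) → 0 ≤ ηplus →
      Λ * Real.exp (ηplus - C.κ₁) < 1 →
      ∀ {Λ' : ℝ}, 0 ≤ Λ' → Λ' * Real.exp (-C.κ₁) * Real.exp ηplus < 1 →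
      (a + μ * ν * (Λ' * Real.exp (-C.κ₁) / (1 - Λ' * Real.exp (-C.κ₁) * Real.exp ηplus))) * Real.exp ηplus ≤
        Real.exp ηplus - 1 →
      ∀ (y : ℕ → ℕ → γ → Gen PEv → ℝ),
      (∀ K, ∀ j ≤ K, ∀ z ∈ Cell K (K - j), ∀ G ∈ runFam Lren Lmer Lpart Lroot Ncap K j, 0 ≤ y K j z G) →
      (∀ K, K₀ ≤ K → ∀ j ≤ K, ∀ z ∈ Cell K (K - j), ∀ G ∈ runFam Lren Lmer Lpart Lroot Ncap K j,
        y K j z G ≤ 0 ∨ ∃ G' : Gen ε, ConsistentT sh C K (R K) G' ∧ G'.WF (dictWT sh (R K) C.n₁) ∧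
          K < G'.reach (dictWT sh (R K) C.n₁) ∧ relabel (shape ∘ sh) G' = G ∧
          y K j z G ≤ Λ' ^ partnerAges (PEv.step ∘ sh) G' * (Real.exp (-credits (credit C (g K) ∘ sh) G') *
            Real.exp (lifeCost (dictWT sh (R K) C.n₁) (costT sh C K (R K)) G'))) →
      ∀ (str : ℕ → κ → Finset (BSlot γ PEv)),
      (∀ K t, |t| ≤ l₀ → K₀ ≤ K → Set.InjOn (str K) (Bad' K t)) →
      (∀ K t, |t| ≤ l₀ → K₀ ≤ K → ∀ c ∈ Bad' K t,
        str K c ⊆ bliveSlots Cell (runFam Lren Lmer Lpart Lroot Ncap) K ∧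
          ∃ o ∈ boldSlots Cell (runFam Lren Lmer Lpart Lroot Ncap) jstar K, o ∈ str K c) →
      (∀ K t, |t| ≤ l₀ → K₀ ≤ K → ∀ c ∈ Bad' K t, F K c * Rf K c ≤ famWeight (bslotPrice (y K)) (str K c)) →
      (∀ K t, |t| ≤ l₀ → K₀ ≤ K → ∀ c ∈ Bad' K t, F' K c * Rf' K c ≤ famWeight (bslotPrice (y K)) (str K c)) →
      ∃ K₁, K₀ ≤ K₁ ∧ RelWeightBound l₀ T A A' (fun K t => if K₁ ≤ K then badOfClass π T Bad' K t else ∅)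
        (Set.indicator {K | K₁ ≤ K} (fun K => Cn * recordsBudget ρbar C.κ₁ V Λ ηplus jstar K)) := by
  obtain ⟨x₀, hx₀⟩ := exists_irThresholdT sh C hC ha₀ hA₀ hL hβ hrq
  refine ⟨x₀, ?_⟩
  intro R g β' h27 h29 hR hx1 hir ρbar a μ ν ηplus hρbar ha hμ hν hηplus hr Λ' hΛ0 h1 hx y hy0 hlabT str hinj hstr
    hF hF'
  exact exists_relWeightBound_of_bankingT sh hC.κ₁_nonneg R g
    (fun K hK => hx₀ K (R K) (g K) (β' K) (h27 K hK) (h29 K hK) (hR K hK) (hx1 K hK) (hir K hK))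
    Cell hV hΛ hcell Lren Lmer Lpart Lroot Ncap hst hρbar ha hμ hν hηplus hr hΛ0 h1 hx jstar hj hc hfrac y hy0 hlabT
    str hinj hstr hA hA' hF hF' hCn

end EndToEndT

/-! ## §7 Conservative extension: at `ε = PEv`, `sh = id` the tagged objects ARE the untagged ones -/

section Untagged

variable (C : T4PrintedShapeBanking.Consts) (K : ℕ) (R : ℕ → ℕ)

/-- the untagged table [folklore] -/
theorem dictWT_id (n₁ : ℕ) : dictWT (id : PEv → PEv) R n₁ = dictW R n₁ := rfl

/-- the untagged booked cost (definitionally) [folklore] -/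
theorem costT_id : costT (id : PEv → PEv) C K R = cost C K R := rfl

/-- the untagged extension (definitionally) [folklore] -/
theorem extnT_id : extnT (id : PEv → PEv) C K R = extn C K R := rfl

/-- the untagged admissibility [folklore] -/
theorem consistentT_id_iff : ∀ (G : Gen PEv), ConsistentT (id : PEv → PEv) C K R G ↔ Consistent C K R G
  | Gen.born b j => Iff.rfl
  | Gen.renew G e h => by
      show ConsistentT id C K R G ∧ _ ↔ Consistent C K R G ∧ _
      exact and_congr (consistentT_id_iff G) Iff.rfl
  | Gen.merge X Y e => by
      show ConsistentT id C K R X ∧ ConsistentT id C K R Y ∧ _ ↔ Consistent C K R X ∧ Consistent C K R Y ∧ _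
      exact and_congr (consistentT_id_iff X) (and_congr (consistentT_id_iff Y) Iff.rfl)

/-- … as predicates [folklore] -/
theorem consistentT_id : ConsistentT (id : PEv → PEv) C K R = Consistent C K R :=
  funext fun G => propext (consistentT_id_iff C K R G)

end Untagged

/-! ## §8 Sanity: a physical history with PARALLEL EQUAL BIRTHS is a well-formed consistent TAGGED genealogy whose shape
is a counted branching record with NO well-formed shape-preimage over `PEv`; `hlabT` inhabited on it -/

section Sanity

namespace Sanity

open T4PrintedShapeBanking.XreadC4

/-- tagged labels: a dictionary event and a branch-local ordinal [folklore] -/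
abbrev TEv := PEv × ℕ

/-- branch `0`: a thin region born at step `0` (label `((0,0,0), 0)`), renewed at readiness `4` [folklore] -/
def Xt : Gen TEv := Gen.renew (Gen.born (((0, 0, 0) : PEv), 0) 0) (((4, 1, 0) : PEv), 0) 3
/-- branch `1`: ANOTHER thin region born at the SAME step `0` with the SAME class (label `((0,0,0), 1)`), renewed at the
same step `4` [folklore] -/
def Yt : Gen TEv := Gen.renew (Gen.born (((0, 0, 0) : PEv), 1) 0) (((4, 1, 0) : PEv), 1) 3
/-- the two branches merge at step `5` [folklore] -/
def Zt : Gen TEv := Gen.merge Xt Yt (((5, 2, 0) : PEv), 0)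
/-- its shape: the genealogy TERM over class shapes with the birth label `(0,0,0)` and the renewal label `(4,1,0)` in
BOTH branches — a branching record [folklore] -/
def Zflat : Gen PEv :=
  Gen.merge (Gen.renew (Gen.born (0, 0, 0) 0) (4, 1, 0) 3) (Gen.renew (Gen.born (0, 0, 0) 0) (4, 1, 0) 3) (5, 2, 0)

/-- forgetting the tags gives the flat term, [folklore] -/
theorem relabel_fst_Zt : relabel Prod.fst Zt = Zflat := rfl

/-- and so does the shape-relabelling (all classes here are `0`) [folklore] -/
theorem relabel_shape_Zt : relabel (shape ∘ Prod.fst) Zt = Zflat := by decide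

/-- **THE TAGGED HISTORY IS WELL FORMED** on the cross-read's table `R ≡ 2`, `n₁ = 1` (the two births carry different
tags, so the partners' label sets are disjoint) … [folklore] -/
theorem Zt_wf : Zt.WF (dictWT Prod.fst (fun _ => 2) C₀.n₁) := by
  simp [Gen.WF, Zt, Xt, Yt, C₀, Gen.reach, Gen.rootStep, dictW, PEv.kind, PEv.fat, fatWait]

/-- … **AND CONSISTENT at the cutoff `K = 8`, at which it is still pending** (births of kind `0` at step `0`; renewals of
kind `1` at readiness `4 = 0 + (1 + 2 + 1)`; merger of kind `2` at step `5 ∈ [0, 7)` for both partners; merged reach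
`7 + (1 + 2) = 10 > 8`). [folklore] -/
theorem Zt_consistent : ConsistentT Prod.fst C₀ 8 (fun _ => 2) Zt ∧ 8 < Zt.reach (dictWT Prod.fst (fun _ => 2) C₀.n₁) := by
  constructor
  · simp [ConsistentT, Zt, Xt, Yt, C₀, Gen.reach, Gen.rootStep, dictW, PEv.kind, PEv.step, PEv.fat, fatWait]
  · simp [Zt, Xt, Yt, C₀, Gen.reach, dictW, PEv.kind]

/-- **THE FLAT TERM IS COUNTED**: `Zflat ∈ fam (n + 3) {(0,0,0)} 0 8` for the one-label menus of
`T4BranchingRecordsGas` §8 (thin partner births `{(s,0,0)}`; fuel kept symbolic). [folklore] -/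
theorem Zflat_mem (n : ℕ) :
    Zflat ∈ fam T4BranchingRecordsGas.Sanity.Lren T4BranchingRecordsGas.Sanity.Lmer T4BranchingRecordsGas.Sanity.Lpart
      (n + 3) (T4BranchingRecordsGas.Sanity.Lpart 0) 0 8 := by
  have hb : ∀ m K, Gen.born ((0, 0, 0) : PEv) 0 ∈ fam T4BranchingRecordsGas.Sanity.Lren T4BranchingRecordsGas.Sanity.Lmer
      T4BranchingRecordsGas.Sanity.Lpart (m + 1) (T4BranchingRecordsGas.Sanity.Lpart 0) 0 K :=
    fun m K => born_mem_fam (by simp [T4BranchingRecordsGas.Sanity.Lpart])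
  have hX : ∀ m, Gen.renew (Gen.born ((0, 0, 0) : PEv) 0) (4, 1, 0) 3 ∈ fam T4BranchingRecordsGas.Sanity.Lren
      T4BranchingRecordsGas.Sanity.Lmer T4BranchingRecordsGas.Sanity.Lpart (m + 2) (T4BranchingRecordsGas.Sanity.Lpart 0)
      0 5 :=
    fun m => renew_mem_fam (t := 4) (by simp) (by simp [T4BranchingRecordsGas.Sanity.Lren]) (hb m 4)
  exact merge_mem_fam (t := 5) (by simp) (by simp [T4BranchingRecordsGas.Sanity.Lmer]) (s' := 0) (by simp) (hX n) (hX n)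

/-- … **BUT IS NOT WELL FORMED** for any window table (the birth label `(0,0,0)` — and the renewal label — occur in both
branches), [folklore] -/
theorem Zflat_not_WF (W : PEv → ℕ) : ¬ Zflat.WF W := by
  intro h
  simp [Zflat, Gen.WF, Gen.events] at h

/-- a label whose shape is a birth shape IS that shape (the shape keeps a birth's class) [folklore] -/
theorem eq_of_shape_eq_birth {e : PEv} {s d : ℕ} (h : shape e = ((s, 0, d) : PEv)) : e = ((s, 0, d) : PEv) := by
  obtain ⟨s', k', d'⟩ := e
  simp only [shape, PEv.step, PEv.kind, PEv.fat, Prod.mk.injEq] at h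
  obtain ⟨h1, h2, h3⟩ := h
  subst h1; subst h2
  simp at h3
  subst h3
  rfl

/-- **… AND HAS NO WELL-FORMED SHAPE-PREIMAGE OVER `PEv` WHATSOEVER**: any genealogy over the dictionary's events whose
shape-relabelling is `Zflat` has both births labelled `(0,0,0)` (`eq_of_shape_eq_birth`), hence intersecting partner label
sets — the labelled branch of `T4BranchingRecordsGas`'s binder `hlabB` is unsatisfiable at this counted term.  This is
symptom (ii) of GAPS G-ne7bp1g12-1 (LM), kernel-witnessed. [folklore] -/
theorem no_wf_shapePreimage_Zflat (W : PEv → ℕ) (G : Gen PEv) (hG : relabel shape G = Zflat) : ¬ G.WF W := by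
  intro hW
  rcases G with ⟨b, j⟩ | ⟨G₁, e, h⟩ | ⟨X, Y, e⟩
  · simp [Zflat] at hG
  · simp [Zflat] at hG
  · rcases X with ⟨b₁, j₁⟩ | ⟨X₁, e₁, h₁⟩ | ⟨X₁, X₂, e₁⟩
    · simp [Zflat] at hG
    · rcases X₁ with ⟨b₁, j₁⟩ | ⟨X₃, e₃, h₃⟩ | ⟨X₃, X₄, e₃⟩
      · rcases Y with ⟨b₂, j₂⟩ | ⟨Y₁, e₂, h₂⟩ | ⟨Y₁, Y₂, e₂⟩
        · simp [Zflat] at hG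
        · rcases Y₁ with ⟨b₂, j₂⟩ | ⟨Y₃, e₄, h₄⟩ | ⟨Y₃, Y₄, e₄⟩
          · simp only [relabel_merge, relabel_renew, relabel_born, Zflat, Gen.merge.injEq, Gen.renew.injEq,
              Gen.born.injEq] at hG
            obtain ⟨⟨⟨hb₁, -⟩, -, -⟩, ⟨⟨hb₂, -⟩, -, -⟩, -⟩ := hG
            have e1 := eq_of_shape_eq_birth hb₁
            have e2 := eq_of_shape_eq_birth hb₂
            subst e1; subst e2
            simp [Gen.WF, Gen.events] at hW
          · simp [Zflat] at hG
          · simp [Zflat] at hG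
        · simp [Zflat] at hG
      · simp [Zflat] at hG
      · simp [Zflat] at hG
    · simp [Zflat] at hG

/-- **`hlabT` IS MET ON THE COUNTED TERM `Zflat`** (with `Λ′ = 1` and the raw factor of `Zt` as the price): the tagged
history `Zt` is the witness.  So `treeShape_of_labelT` / `exists_irThreshold_relWeightBoundT` are not vacuous on
histories with parallel equal births — where `hlabB` could not be met (`no_wf_shapePreimage_Zflat`). [folklore] -/
example (g : ℕ → ℝ) {y : ℝ}
    (hy : y ≤ (1 : ℝ) ^ partnerAges (PEv.step ∘ Prod.fst) Zt *
      (Real.exp (-credits (credit C₀ g ∘ Prod.fst) Zt) *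
        Real.exp (lifeCost (dictWT Prod.fst (fun _ => 2) C₀.n₁) (costT Prod.fst C₀ 8 (fun _ => 2)) Zt))) :
    y ≤ 0 ∨ ∃ G' : Gen TEv, ConsistentT Prod.fst C₀ 8 (fun _ => 2) G' ∧ G'.WF (dictWT Prod.fst (fun _ => 2) C₀.n₁) ∧
      8 < G'.reach (dictWT Prod.fst (fun _ => 2) C₀.n₁) ∧ relabel (shape ∘ Prod.fst) G' = Zflat ∧
      y ≤ (1 : ℝ) ^ partnerAges (PEv.step ∘ Prod.fst) G' *
        (Real.exp (-credits (credit C₀ g ∘ Prod.fst) G') *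
          Real.exp (lifeCost (dictWT Prod.fst (fun _ => 2) C₀.n₁) (costT Prod.fst C₀ 8 (fun _ => 2)) G')) :=
  Or.inr ⟨Zt, Zt_consistent.1, Zt_wf, Zt_consistent.2, relabel_shape_Zt, hy⟩

/-- the partner ages of the tagged history: the partner born at `0` merging at `5` has age `5 + 1 − 0 = 6` — within the
surplus `min 7 7 − max 0 0 = 7` (`partnerAges_le_windowSurplusT` at numbers) [folklore] -/
example : partnerAges (PEv.step ∘ Prod.fst) Zt = 6 ∧ windowSurplus (dictWT Prod.fst (fun _ => 2) C₀.n₁) Zt = 7 := by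
  constructor
  · decide
  · simp [windowSurplus, Zt, Xt, Yt, C₀, Gen.reach, Gen.rootStep, dictW, PEv.kind, PEv.fat, fatWait]

/-- the tree weight of the shape is read off the tags: root residual of `(0,0,0)`, age factor `θ^6`, and the residuals
of the other birth, both renewals and the merger (`treeWt_relabel_shapeT` at the example) [folklore] -/
example (g : ℕ → ℝ) (θ : ℝ) :
    treeWt (rho C₀ g) (eta C₀) θ PEv.step Zflat =
      rho C₀ g (0, 0, 0) * θ ^ 6 * (eta C₀ (4, 1, 0) * (eta C₀ (0, 0, 0) * eta C₀ (4, 1, 0)) * eta C₀ (5, 2, 0)) := by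
  simp only [treeWt, Zflat, npNR_renew, npNR_merge, npNR_born, npAll_renew, npAll_born, partnerAges_renew,
    partnerAges_merge, partnerAges_born, root_renew, root_merge, root_born, Gen.rootStep_renew, Gen.rootStep_born,
    PEv.step_mk]
  norm_num

end Sanity

end Sanity

end

end T4TaggedShapeBanking

end Literature.MathematicalPhysics.QuantumFieldTheory.Balaban1983to89
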